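import Mathlib
import Literature.MathematicalPhysics.QuantumFieldTheory.Balaban1983to89.T4EtaRateMin
import Literature.MathematicalPhysics.QuantumFieldTheory.Balaban1983to89.B11HessianL2

/-!
# T4ConvexResponse — the ENERGY-CONVEXITY route to the response bound of NE3: strong convexity of Bałaban's chart functional 𝔉 (74) ⇒ Lipschitz response of the constrained minimiser in the energy norm, with explicit modulus (cell `pub-balaban`, T4-DAG node U1 (b), spine estimate NE3, row T4-U1b.NE3-PROVE-P2*; folklore convex analysis + bookkeeping)

HONEST FRAMING (cell `pub-balaban`, T4-DAG PAGE 1).  The cell's T4 target is the existence AND uniqueness of the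
continuum limit of Bałaban's unit-scale averaged loop expectations on a FINITE torus T⁴ — a constructive-QFT
statement strictly beyond ultraviolet stability; there is NO mass gap statement here, it is NOT the Clay problem and
NOT summit progress.  This module is the kernel part of ONE technique seat (energy-convexity, P2) for the cell's NEW
ESTIMATE NE3 = "η-rate of the minimisers" (node U1 (b); NE3 is by the cell's DAG §3 free of the conditionals
BetaPertH, (B), (B^μ), and nothing below mentions them).  §§1–3 are [folklore] one-variable / affine convex analysis
(strong convexity along segments ⇒ response of the constrained minimiser to a competitor's residual, quadratic action
gap, two-data Lipschitz form), kernel-proved from Mathlib with NO topology on the field space; §4 is linear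
bookkeeping (the residual-pairing identity behind the energy route's RATE); §5 is `Real.rpow` bookkeeping (energy
rate ⇒ sup rate under an interpolation hypothesis); §6 assembles the pieces into the tree shape
`T4EtaRateMin.LocalRate`.  Every `def … : Prop` is a HYPOTHESIS SHAPE over an abstract carrier (a predicate, never a
fact).  NOTHING is asserted about Bałaban's configurations, operators or norms: whether the shapes hold for them is
the paper-level content of the record HOME/t4/T4-EST-NE3-P2.md (this seat), where the first non-following step is
localised.  Value = kernel certificate of the mechanism "strict convexity ⇒ Lipschitz minimiser with modulus 1/m" in
exactly the form the B11 chart provides + typed inputs of the rate; NOT summit progress.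

CITATION HEADER (lean-in-tree rule 2026-08-18).  Source whose displayed formulas are READ (never cited as
establishing a disputed step — it is a manuscript under audit): T. Bałaban, *The variational problem and background
fields in renormalization group method for lattice gauge theories*, Commun. Math. Phys. **102** (1985) 277–309,
doi:10.1007/bf01229381 = [Balaban1985Variational] (cell paper B11, held `paper:balaban1985-cmp102-variational-
background`; pages below read by this seat on the rendered journal pages, PDF page = journal page − 276).

PRINTED CONTEXT (verbatim).
* p. 278: "We consider the functional A(U) = A^η(U) = Σ_{p⊂Ω₀} η^{d−4}[1 − Re tr U(∂p)], η = L^{−k} (5) on the space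
  of gauge field configurations 𝔘_k({Ω_j}, ε₀) ∩ 𝔅_k(𝔅_k, V) (6)", the constraint space being "Ū^j = V on Λ_j,
  j = 0, 1, …, k, (3)".  p. 280: "We assume that we have a configuration U₀ satisfying U₀ ∈ 𝔘_k({Ω_j}, C₁B₃ε₁),
  |Ū₀ʲ − V| < C₁ε₁ on Λ_j, j = 0, 1, …, k, (14) for some absolute constant C₁."
  [cite: Balaban1985Variational, (3), (5), (6) p. 278; (14) p. 280]
* p. 282: "A(U₁U₀) = … = A(U₀) + Σ_{p⊂Ω₀} η^{d−2} Im tr(DA)(p)U₀(∂p) + ½⟨A, ΔA⟩ + V₀(A), (26) where the expansion of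
  V₀(A) begins with a third order polynomial. From hermiticity of DA we have Σ_{p⊂Ω₀} η^{d−2} Im tr(DA)(p)U₀(∂p) =
  Σ_{p⊂Ω₀} η^{d−2} tr(DA)(p) Im U₀(∂p) = ⟨A, J⟩, (27) where J = D*η^{−2} Im ∂U₀ = Im η^{−2}D*∂U₀, |J| <
  C₁B₃ε₁(L^jη)^{−3} on Ω_j, (28) the bound holds by the assumption (14)."  [cite: Balaban1985Variational, (26)–(28)
  p. 282]
* p. 289: "We make the change of variables (47) and we consider the functional 𝔉(A′) = A(U₀) + ⟨A′ − HD(A′), J⟩ +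
  ½⟨A′ − HD(A′), Δ_π(A′ − HD(A′))⟩ + V₀(A′ − HD(A′)) (74) on the space of field configurations A′ satisfying
  L^jηQ_jA′ = B on Λ_j, j = 0, 1, …, k, |B| < 2dLC₁ε₁, (75) RD*(A′ − HD(A′)) = RD*A′ = 0, (76)"; p. 290: "|A′| <
  ε₃(L^jη)^{−1}, |∇A′| < ε₃(L^jη)^{−2} on Ω_j, j = 0, 1, …, k. (77)" … "Now let us write higher order terms. They
  determine the functional V(A′) = −⟨HD₃(A′), J⟩ − ⟨A′, Δ_πHD(A′)⟩ + ½⟨HD(A′), Δ_πHD(A′)⟩ + V₀(A′ − HD(A′)). (80)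
  It is analytic in A′ for A′ with values in the complexified algebra and satisfying (77). We consider the functional
  𝔉(A′) = A(U₀) + ⟨A′, J⟩ + ½⟨A′, Δ₁A′⟩ + V(A′) (81) on the space of configurations A′ satisfying (75)–(77). To
  find critical points of this functional we have to find A′ in the considered space, such that the equation
  ⟨(δ/δA′)𝔉(A′), δA′⟩ = 0 (82) holds for all δA′ in the tangent space, that is δA′ satisfying the conditions
  QδA′ = 0, RD*δA′ = 0. (83) We have to calculate the functional derivative of 𝔉(A′). From (81) we have
  ⟨(δ/δA′)𝔉(A′), δA′⟩ = ⟨δA′, J⟩ + ⟨δA′, Δ₁A′⟩ + ⟨(δ/δA′)V(A′), δA′⟩. (84)"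
  [cite: Balaban1985Variational, (74)–(76) p. 289; (77), (80)–(84) p. 290]
* p. 295: "A solution of Eq. (111) is a fixed point of the transformation A₁ → −𝔊J − 𝔊((δ/δA′)V)(A₁ + H₁B). (116)"
  … "Proposition 6. There exists a positive, absolute constant a₄ such, that for ε₄ ≤ a₄ and ε₁ satisfying
  2B₀C₁B₃ε₁ ≤ ε₄ Eq. (111) has exactly one solution in the space (115). This solution satisfies the bounds (115)
  with ε₄ = 3B₀C₁B₃ε₁."  [cite: Balaban1985Variational, (116), Prop. 6 p. 295]
* p. 299: "To see that U_k is a minimum we apply the whole procedure with the configuration U_k instead of U₀. We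
  get a functional 𝔉(A′) for which the critical configuration is equal to 0. This implies that a differential of
  𝔉(A′) at A′ = 0 is equal to ⟨δA′, J⟩ and Eq. (93) has the form ⟨δA′, J⟩ = 0 for all δA′: QδA′ = 0,
  RD*δA′ = 0. (141) Further, let us notice that B = 0, hence the configurations A′ satisfy the same conditions as
  δA′, and we have ⟨A′, J⟩ = 0. Thus the expansion (81) for this functional has the form 𝔉(A′) = A(U_k) +
  ½⟨A′, Δ₁A′⟩ + V(A′). (142) A second order differential at A′ = 0 is given by the quadratic form above, and it is
  positive definite."  [cite: Balaban1985Variational, (141)–(142) p. 299]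

WHAT IS CELL-SUPPLIED, NOT PRINTED (never cited as a fact; enters below ONLY as the hypothesis shape
`StrongSecondVariation`, modulus `m`): the lemma ML of the cell record HOME/b2b-balaban-b11-g5/ML-SUPPLIED.md
(kernel skeleton = tree module `…B11HessianL2`, p180426): for ε₁, ε₃ below a (d, L, N)-threshold (its smallness
clause S-B11.12), d²/dt²|₀ 𝔉(A′ + tW) ≥ ½c_* N(W)² for every A′ in the chart K = {(75), (76), (77)} and every
tangent direction W ∈ T = {QW = 0, RD*W = 0}, with N(W)² = ‖D_{U₀}W‖² + Σ_j (L^jη)^{−2}‖W‖²_{Ω_j∖Ω_{j+1}} and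
c_* = ¼ min{1, (L B₀ c₁(½))^{−1}}.  In the dictionary below m = ½c_*, so the response modulus is 1/m = 2/c_* =
8 max{1, L B₀ c₁(½)}.

WHAT IS NOT PRINTED (census of the cell records T4-XREAD-U1b §3, T4-XREAD-U1b-L3 §3, T4-EST-U1b §6, and of this
seat's reading of pp. 278–299): (i) any response / Lipschitz / two-data statement for the minimiser — every printed
radius (Prop. 6, p. 295, Prop. 7 p. 299) is const·C₁B₃ε₁, i.e. (28) majorises the residual J by the REGULARITY
radius of (14) at once, so the residual is never separated from the regularity radius; (ii) any comparison of the
k-step and (k+1)-step minimisers for the same datum V, any rate in η; (iii) strong (or any) convexity of 𝔉 on the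
whole chart — p. 299 prints positive-definiteness of the second differential AT the critical point only ((142)).

THE ENERGY ROUTE (this seat's [analysis]; the dictionary, NOT a quotation).  Take as background the one-step block
average W_k(V) of the finer minimiser U_{k+1}(V) (run B), ASSUMING it is admissible in (14) with B = 0 in (75)
(R0: its iterated averages reproduce V, cf. (3) and p. 299 "B = 0"; regularity of an average of a regular field —
printed-TYPE ingredients, not a printed sentence).  Then the run-A minimiser U_k(V) is Φ(A′*) for the constrained
critical point A′* ∈ K of 𝔉, K is CONVEX (an affine space ∩ the box (77)), A′ = 0 ∈ K is the competitor "W_k(V)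
itself", and along the segment t ↦ tA′* ⊂ K: φ′(1) = D𝔉(A′*)[A′*] = 0 by (82)–(83) (B = 0 makes A′* a tangent
direction, exactly as on p. 299), φ′(0) = D𝔉(0)[A′*] = ⟨A′*, J⟩ by (81)/(84) (V = (80) is of third order), and
φ″ ≥ m N(A′*)² by ML.  Hence (§1, `response_of_strongConvexity`) N(A′*) ≤ r/m with r := sup{|⟨J, W⟩| : W ∈ T,
N(W) ≤ 1} the DUAL ENERGY NORM of the residual J = Im η^{−2}D*∂W_k(V) ON THE TANGENT SPACE — not its sup norm
|J|_(−3) of (117) —, and (§3) the action gap 𝔉(0) − 𝔉(A′*) = A^η(W_k(V)) − A^η(U_k(V)) lies in [m N²/2, r²/(2m)].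
The RATE then rests on r = r_k(V) ≤ ρ θ^k (R2^E, NOT printed): §4 records the identity that makes r small — for a
tangent direction W lifted to a run-B tangent direction ψ under the linearised averaging, ⟨J(W_k), W⟩ = D𝓓(U_{k+1})[ψ]
with 𝓓 = A^η∘avg − A^{η/L} the ACTION DEFECT of one averaging step (U_{k+1} is critical for A^{η/L}) — so r is
controlled by a DERIVATIVE BOUND FOR THE DEFECT (shape `DefectDerivBound`, the typed missing inequality) times a
LIFT CONSTANT (shape `TangentLift`); §5 converts an energy rate θ_E into a sup rate θ_E^a under an interpolation
hypothesis (a = 2/(d+2) for Lipschitz-regular fields, (9)–(10)-type uniform regularity); §6 assembles the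
ACTION reading (extensive; no localisation needed) at rate θ_E² and local readings at rate θ_E given a LOCALISED
response (pointwise readings need a localisation δ of the energy response: §8 (v1.6) kernel-proves its algebraic
core — the abstract Agmon weighted-energy estimate, uniform in η — and names what remains cell-level (record §5b);
the sibling seat's weighted-sup contraction is the alternative).
Record: HOME/t4/T4-EST-NE3-P2.md.

WHAT IS PROVED HERE (0 sorry; tags per declaration).
§1 `slope_lower`, `taylor_lower`, `taylor_upper` (one real variable: ψ″ ≥ μ on [0,1] ⇒ ψ′(t) − ψ′(s) ≥ μ(t − s),
ψ(1) − ψ(0) ∈ [ψ′(0) + μ/2, ψ′(1) − μ/2]); `deriv_nonneg_of_isMinOn_segment` (one-sided Fermat);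
§2 over a real vector space E (NO topology): `ChartC2` (C² along segments of a convex chart, derivative `d𝔉`,
second variation `h𝔉`), shape `StrongSecondVariation K h𝔉 N m` and its derivation from the TANGENT form of ML
(`strongSecondVariation_of_tangent`); `chartConvex_of_strongSecondVariation` (the same package gives
`B11GlobalMin.ChartConvex K 𝔉` via `B11HessianL2.chartConvex_of_second_variation` — one supplied lemma serves the
global-minimum reading and the response); `variationalIneq_of_isMinOn` (minimiser on K ⇒ D𝔉(x*)[w − x*] ≥ 0);
`response_of_strongConvexity` (N(w − x*) ≤ r/m from the VI at x* and the residual bound D𝔉(w)[w − x*] ≤ r N(w − x*));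
`response_of_isMinOn`; §3 `actionGap_lower`, `actionGap_upper` (m N²/2 ≤ 𝔉 w − 𝔉 x* ≤ r²/(2m)),
`twoData_response` (minimisers of two functionals on one chart: N(x₂* − x₁*) ≤ δ/m, δ = dual norm of
(D𝔉₁ − D𝔉₂)(x₂*)); §4 `residual_pairing` (⟨D𝒜_c(P u), φ⟩ = D𝓓(u)[ψ] for a tangent lift ψ of φ at a critical u),
shapes `DefectDerivBound`, `TangentLift`, and `dualResidual_le` (⇒ |D𝒜_c(P u) φ| ≤ Λ δ N φ);
`stencil_consistency` (a unit-mass stencil of width ρ reproduces F up to Lip(F)·ρ — the linearised source of the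
rate θ_E = L^{−1}); `stencil_energyDefect_eq` / `stencil_energyDefect_le` (for a reversible unit-mass stencil the
energy defect Σ m F (F − wF) is half the weighted variance, ≤ ½ (Lip F · ρ)² Σ m — two powers of the width: the
linearised source of the rate L^{−2} for the ACTION reading); `stencil_consistency2` (a CENTRED unit-mass stencil —
one annihilating the linear part of F — reproduces F up to (Λ₂/2)·ρ² under a second-order Taylor bound: two powers
for C² data; the stencil S*S of the linearised line-average block operator IS centred, record §3.6) and
`weightedSq_split` (Σ m g² ≤ a²·m(K) + b²·m(all) when |g| ≤ a on a layer set K and ≤ b off it — with a = Lip F · ρ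
on the ρ-layer along the unit-block faces and b = (Λ₂/2)ρ² elsewhere this is the L²-rate ρ^{3/2} of the linearised
toy, available in the full model only under a piecewise-C² structure of the curvature that (9)–(10) do not print);
§4b the DRESSED (non-abelian) forms carrying the leading terms of the record's Appendix β (second-order expansion of
the one-step averaging B4 (15) around a covariantly-Lipschitz small field): `stencil_consistency_dressed` (a SIGNED
unit-mass stencil of parallel-transported values reproduces F up to (Σ|σ|)·(covariant oscillation) — the leading
term of the defect DERIVATIVE, size K₁ε₁η) and `jensen_deficit` / `jensen_deficit_le` (‖Σσ•v‖² = Σσ‖v‖² − ½ΣΣσσ‖v_p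
− v_q‖² in a real inner-product space; with σ ≥ 0 the deficit lies in [0, ½κ²], κ = covariant oscillation — the
leading term of the defect VALUE, size (K₁ε₁η)²);
§4c the L² FORMS, which free the energy route from the Hölder endpoint (9)_{β₀=1} (stated in B11 Thm 1, located as
underived in print by the cell's B11 lineage, GAPS G-B11-F3a / HOLDER-9 (R1); objection G-B11-F3a-T4NE3-HOLDER on this
leaf's v1–v1.3 docstrings ACKNOWLEDGED): `jensen_sq` (‖Σσ•v‖² ≤ Σσ‖v‖²), `stencil_L2_defect_le_variance` (the L²
stencil defect is at most the weighted variance — no Lipschitz bound needed), `telescope_sq_le` (‖v_n − v_0‖² ≤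
n Σ‖v_{l+1} − v_l‖²: the Poincaré step along a dressing path, turning the variance into η² × the L² norm of the
covariant gradient of F) and `sum_normSq_comp_eq_normSq_laplacian` (for a commuting normal family of operators — the
lattice translations' difference quotients on a torus — Σ_{μν}‖D_μD_νA‖² = ‖Σ_μD_μ†D_μA‖²: ALL mixed second differences
are controlled in L² by the Laplacian, although not in sup norm (cell numerics N-B8-4) — so the printed sup bounds (9)ˢᵘᵖ
(:= the entries |A|, |∇^ηA| of (9)) and (10) supply ‖∇F‖_{L²}, which is all the energy route consumes);
§4d the CUTOFF (localised) form of that identity, `sum_inner_comp_cutoff_eq`: for the same commuting normal family and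
ANY symmetric operator P (multiplication by χ² in the dictionary) Σ_{ij}⟨D_iD_ju, P D_iD_ju⟩ = ⟨Δu, PΔu⟩ −
Σ_j⟨D_ju, K_jΔu⟩ − Σ_{ij}⟨K_iD_ju, D_iD_ju⟩ with the commutators K_i = D_iP − PD_i (on the lattice K_i = multiplication
by ∇_i(χ²) followed by a unit shift, supported where ∇χ ≠ 0 and of size ≲ 1/M) — the summation-by-parts core of the
discrete Caccioppoli inequality for second differences (interior H² from the Laplacian, cube by cube, as B11 Thm 1
is stated), plus the absorption arithmetic `le_of_le_add_mul_sqrt`; P = 1 recovers §4c's torus identity;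
§5
`localRate_of_interpolation` (energy distance ≤ C_E θ_E^k and |Δ sup-reading| ≤ C_I E^a M^{1−a} ⇒
`LocalRate R (C_I C_E^a M^{1−a}) (θ_E^a)`), `rpow_rate_lt_one`; §6 `localRate_of_energyResponse` (R1^E + R2^E + a
reading Lipschitz in the energy distance + an averaging term ⇒ `LocalRate`), `actionGap_rate` (the action reading
carries r², i.e. rate θ²), `actionRate_of_energyRoute` (|Δact| ≤ gap + defect value, gap ≤ r²/(2m), r ≤ ρ θ_E^k √vol,
|defect| ≤ C_D θ_E^{2k} vol ⇒ `ActionRate R (ρ²/(2m) + C_D) (θ_E²)` — the extensive reading needs no localisation);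
§7 non-vacuity (`Witness`: 𝔉 = x² on ℝ satisfies `ChartC2` and `StrongSecondVariation`
with m = 2, and the response bound is attained);
§8 (v1.6) the two LOCALISATION CORES behind the δ-input of the pointwise readings (record §5b, GAPS G-ne3p2-3):
`agmon_weighted_response` (abstract Agmon / Combes–Thomas estimate over a bare real vector space: an m-coercive form
whose conjugation defect under a weight map w is ≤ κ < m has weak solutions with N(w u) ≤ ρ/(m − κ), ρ the w-weighted
dual gauge of the source — uniform in the lattice spacing, the conjugation defect of nearest-neighbour difference forms
being the discrete IMS identity `ims_bond_identity` / `ims_bond_defect_le`), `weightedDual_of_local` (a source made of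
local pieces has weighted dual gauge Σ weights × local dual gauges — volume-free iff that sum converges), and the
banded Neumann-series bound `local_response_decay` (+ `_sum`; |⟨x, H⁻¹y⟩| ≤ (1 − m/Λ)^{N/2}‖x‖‖y‖/m across N support
layers — adequate for unit-lattice operators with Λ/m = O(1), NOT uniform in η for the fine-lattice Hessian, which is
why δ is routed through the Agmon form), `agmon_witness` (non-vacuity with equality); §8d (v1.7) the typed shapes
`ConjugationDefect` / `WeightedDualBound` (+ `agmon_of_shapes`; v1.8 `agmon_constrained`: weak equation only on a
subspace T, Agmon test vector corrected into T at quadratic form-cost κ₂ and linear source-cost ρ₂ ⇒ N(wu) ≤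
(ρ + ρ₂)/(m − κ − κ₂) — the shape of (δ1)+(δ2)) and the MODEL DISCHARGE of the conjugation-defect
shape on the §7b lattice, uniform in the mesh: `latticeForm` (Σ_i⟨D_iu, D_iv⟩ + s⟨u, v⟩), `latticeForm_coercive`,
`lattice_ims_identity`, `lattice_ims_defect_le` (weight relatively Lipschitz at the mesh scale ⇒ bond defect ≤
μ²‖ωu‖²), `latticeForm_conjugationDefect` (`ConjugationDefect (latticeForm c e s) (mulOp ω) ‖·‖ (#ι·μ²)`),
`lattice_agmon` (‖ωu‖ ≤ ρ/(s − #ι·μ²) for weak solutions); §8e (v1.9) the same DRESSED BY PARALLEL TRANSPORT on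
F-valued fields (F any real inner product space; transports R_i(x) linear isometries of F): `shiftR`, `mulOpF`,
`fwdDiffR`, `ims_vec_identity`, `dressed_ims_identity`, `dressed_ims_defect_le`, `latticeFormR`(+`_apply`,
`_coercive`), `latticeFormR_conjugationDefect`, `dressed_lattice_agmon` — the D_{U₀}-part of (79); §8f (v1.10)
the FINITE-RANGE BLOCK TERMS: `conjugationDefect_add`, `kernelOp`/`kernelForm`(+`_apply`), `schur_amgm`,
`kernelForm_self_le` (Schur bound), `kernelForm_conjugationDefect` (defect ≤ (e^{μ′r} − 1)·Schur norm, typed via a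
dominating kernel δ), `lattice_agmon_perturbed` (‖ωu‖ ≤ ρ/((s − T) − (#ι·μ² + K))) — completing the kernel skeleton
of item (δ3).  CONTINUED (v1.11 pointer, no new declarations here — gate file-size limit) in the sibling module
`…Balaban1983to89.T4ConstrainedAgmon` (same seat lineage, §8g of this plan): items (δ1)+(δ2) REPAIRED — gap-a: the
source cost of the tangent correction is measured in the dual weighted gauge N′ = N ∘ w⁻¹
(`agmon_constrained_tangent_dual`); gap-b: coercivity on the tangent space only, the conjugated field corrected into
it (`agmon_constrained_tangent`) — and DISCHARGED in the block model of §7b/§8d with the ENERGY gauge, the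
block-tangent space and finite-range tangent corrections along exact profile families, down to the one-dimensional
instance `constrained_lattice_agmon_1D` (K blocks of n sites, in-block parabola profiles) with every constant
independent of the mesh n = η⁻¹ and the volume K.
-/

namespace Literature.MathematicalPhysics.QuantumFieldTheory.Balaban1983to89.T4ConvexResponse

open Set Filter Topology
open Literature.MathematicalPhysics.QuantumFieldTheory.Balaban1983to89.T4EtaRateMin (Readings LocalRate ActionRate)

noncomputable section

/-! ## §1 One real variable: second derivative bounded below on `[0,1]` -/

/-- If `ψ′` has derivative `ψ″ ≥ μ` on `[0,1]`, then `ψ′ t − ψ′ s ≥ μ (t − s)` for `0 ≤ s ≤ t ≤ 1` (mean value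
inequality). [folklore] -/
theorem slope_lower {ψ' ψ'' : ℝ → ℝ} {μ : ℝ} (hd : ∀ t ∈ Icc (0:ℝ) 1, HasDerivAt ψ' (ψ'' t) t)
    (hμ : ∀ t ∈ Icc (0:ℝ) 1, μ ≤ ψ'' t) {s t : ℝ} (hs : s ∈ Icc (0:ℝ) 1) (ht : t ∈ Icc (0:ℝ) 1)
    (hst : s ≤ t) : μ * (t - s) ≤ ψ' t - ψ' s := by
  have hc : ContinuousOn ψ' (Icc (0:ℝ) 1) := fun u hu => (hd u hu).continuousAt.continuousWithinAt
  have hdi : DifferentiableOn ℝ ψ' (interior (Icc (0:ℝ) 1)) := by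
    rw [interior_Icc]
    exact fun u hu => (hd u (Ioo_subset_Icc_self hu)).differentiableAt.differentiableWithinAt
  have hge : ∀ u ∈ interior (Icc (0:ℝ) 1), μ ≤ deriv ψ' u := by
    rw [interior_Icc]
    intro u hu
    rw [(hd u (Ioo_subset_Icc_self hu)).deriv]
    exact hμ u (Ioo_subset_Icc_self hu)
  exact (convex_Icc (0:ℝ) 1).mul_sub_le_image_sub_of_le_deriv hc hdi hge s hs t ht hst

/-- Second-order Taylor LOWER bound at the left end: `ψ 1 − ψ 0 ≥ ψ′ 0 + μ/2` when `ψ″ ≥ μ` on `[0,1]`.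
[folklore] -/
theorem taylor_lower {ψ ψ' ψ'' : ℝ → ℝ} {μ : ℝ} (h1 : ∀ t ∈ Icc (0:ℝ) 1, HasDerivAt ψ (ψ' t) t)
    (h2 : ∀ t ∈ Icc (0:ℝ) 1, HasDerivAt ψ' (ψ'' t) t) (hμ : ∀ t ∈ Icc (0:ℝ) 1, μ ≤ ψ'' t) :
    ψ' 0 + μ / 2 ≤ ψ 1 - ψ 0 := by
  -- g(t) = ψ t − ψ′0·t − (μ/2) t² is non-decreasing on [0,1]
  have hg : ∀ t ∈ Icc (0:ℝ) 1,
      HasDerivAt (fun s => ψ s - ψ' 0 * s - μ / 2 * (s * s)) (ψ' t - ψ' 0 * 1 - μ / 2 * (1 * t + t * 1)) t := by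
    intro t ht
    exact ((h1 t ht).sub ((hasDerivAt_id' t).const_mul (ψ' 0))).sub
      (((hasDerivAt_id' t).mul (hasDerivAt_id' t)).const_mul (μ / 2))
  have h0 : (0:ℝ) ∈ Icc (0:ℝ) 1 := by simp
  have hmono : MonotoneOn (fun s => ψ s - ψ' 0 * s - μ / 2 * (s * s)) (Icc (0:ℝ) 1) := by
    refine monotoneOn_of_deriv_nonneg (convex_Icc (0:ℝ) 1)
      (fun u hu => (hg u hu).continuousAt.continuousWithinAt) ?_ ?_
    · rw [interior_Icc]
      exact fun u hu => (hg u (Ioo_subset_Icc_self hu)).differentiableAt.differentiableWithinAt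
    · rw [interior_Icc]
      intro u hu
      rw [(hg u (Ioo_subset_Icc_self hu)).deriv]
      have := slope_lower h2 hμ h0 (Ioo_subset_Icc_self hu) hu.1.le
      nlinarith
  have := hmono h0 (by simp : (1:ℝ) ∈ Icc (0:ℝ) 1) zero_le_one
  simp only at this
  linarith

/-- Second-order Taylor UPPER bound at the right end: `ψ 1 − ψ 0 ≤ ψ′ 1 − μ/2` when `ψ″ ≥ μ` on `[0,1]`.
[folklore] -/
theorem taylor_upper {ψ ψ' ψ'' : ℝ → ℝ} {μ : ℝ} (h1 : ∀ t ∈ Icc (0:ℝ) 1, HasDerivAt ψ (ψ' t) t)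
    (h2 : ∀ t ∈ Icc (0:ℝ) 1, HasDerivAt ψ' (ψ'' t) t) (hμ : ∀ t ∈ Icc (0:ℝ) 1, μ ≤ ψ'' t) :
    ψ 1 - ψ 0 ≤ ψ' 1 - μ / 2 := by
  -- H(t) = ψ′1·t − μ t + (μ/2) t² − ψ t is non-decreasing on [0,1]
  have hH : ∀ t ∈ Icc (0:ℝ) 1,
      HasDerivAt (fun s => ψ' 1 * s - μ * s + μ / 2 * (s * s) - ψ s)
        (ψ' 1 * 1 - μ * 1 + μ / 2 * (1 * t + t * 1) - ψ' t) t := by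
    intro t ht
    exact ((((hasDerivAt_id' t).const_mul (ψ' 1)).sub ((hasDerivAt_id' t).const_mul μ)).add
      (((hasDerivAt_id' t).mul (hasDerivAt_id' t)).const_mul (μ / 2))).sub (h1 t ht)
  have h1' : (1:ℝ) ∈ Icc (0:ℝ) 1 := by simp
  have hmono : MonotoneOn (fun s => ψ' 1 * s - μ * s + μ / 2 * (s * s) - ψ s) (Icc (0:ℝ) 1) := by
    refine monotoneOn_of_deriv_nonneg (convex_Icc (0:ℝ) 1)
      (fun u hu => (hH u hu).continuousAt.continuousWithinAt) ?_ ?_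
    · rw [interior_Icc]
      exact fun u hu => (hH u (Ioo_subset_Icc_self hu)).differentiableAt.differentiableWithinAt
    · rw [interior_Icc]
      intro u hu
      rw [(hH u (Ioo_subset_Icc_self hu)).deriv]
      have := slope_lower h2 hμ (Ioo_subset_Icc_self hu) h1' hu.2.le
      nlinarith
  have := hmono (by simp : (0:ℝ) ∈ Icc (0:ℝ) 1) h1' zero_le_one
  simp only at this
  linarith

/-- One-sided Fermat: if `ψ` has derivative `D` at `0` and `ψ 0 ≤ ψ t` for `t ∈ (0,1)`, then `0 ≤ D`. [folklore] -/
theorem deriv_nonneg_of_isMinOn_segment {ψ : ℝ → ℝ} {D : ℝ} (hD : HasDerivAt ψ D 0)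
    (hmin : ∀ t ∈ Ioo (0:ℝ) 1, ψ 0 ≤ ψ t) : 0 ≤ D := by
  rw [hasDerivAt_iff_tendsto_slope_zero] at hD
  have hD' : Tendsto (fun t => t⁻¹ • (ψ (0 + t) - ψ 0)) (𝓝[>] 0) (𝓝 D) :=
    hD.mono_left (nhdsWithin_mono _ fun t ht => ne_of_gt ht)
  refine ge_of_tendsto hD' ?_
  filter_upwards [Ioo_mem_nhdsGT (zero_lt_one' ℝ)] with t ht
  rw [zero_add, smul_eq_mul]
  exact mul_nonneg (inv_nonneg.mpr ht.1.le) (sub_nonneg.mpr (hmin t ht))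

/-! ## §2 The response of a constrained minimiser, over a real vector space (no topology needed) -/

section Chart

variable {E : Type*} [AddCommGroup E] [Module ℝ E]

/-- C² ALONG SEGMENTS of a convex chart: `𝔉 : E → ℝ` on the convex set `K`, with first variation `d𝔉 x : E →ₗ[ℝ] ℝ`
and second variation `h𝔉 x v` (the quadratic form `Hess 𝔉(x)[v, v]`), in the sense that along every segment
`t ↦ x + t • (y − x)`, `x, y ∈ K`, `t ∈ [0,1]`, the restriction has derivative `d𝔉 (·) (y − x)` and this has
derivative `h𝔉 (·) (y − x)`.  Intended instance: Bałaban's 𝔉 of (74)/(81), analytic on the chart (77) ((80): "It is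
analytic in A′ …"), K = {(75), (76), (77)} with B = 0, `d𝔉` = (84).  An interface, NOT an existence claim.
[cite: Balaban1985Variational, (74)–(77) pp. 289–290, (80)–(84) p. 290] -/
structure ChartC2 (K : Set E) (𝔉 : E → ℝ) (d𝔉 : E → E →ₗ[ℝ] ℝ) (h𝔉 : E → E → ℝ) : Prop where
  convex : Convex ℝ K
  hasDeriv : ∀ x ∈ K, ∀ y ∈ K, ∀ t ∈ Icc (0:ℝ) 1,
    HasDerivAt (fun s : ℝ => 𝔉 (x + s • (y - x))) (d𝔉 (x + t • (y - x)) (y - x)) t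
  hasDeriv2 : ∀ x ∈ K, ∀ y ∈ K, ∀ t ∈ Icc (0:ℝ) 1,
    HasDerivAt (fun s : ℝ => d𝔉 (x + s • (y - x)) (y - x)) (h𝔉 (x + t • (y - x)) (y - x)) t

/-- HYPOTHESIS SHAPE (segment form of the cell-SUPPLIED lemma ML; NOT printed — p. 299 (142) prints positivity of
the second differential at the critical point only): along every segment of the chart the second variation is
`≥ m · N(y − x)²` for an abstract gauge `N` (intended: ML's energy norm N(W)² = ‖D_{U₀}W‖² + ⟨W, 𝒲W⟩, m = ½c_*).
Never used as a fact. [cite: Balaban1985Variational, (142) p. 299 (local statement; the chart-wide bound is not printed)] -/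
def StrongSecondVariation (K : Set E) (h𝔉 : E → E → ℝ) (N : E → ℝ) (m : ℝ) : Prop :=
  ∀ x ∈ K, ∀ y ∈ K, ∀ t ∈ Icc (0:ℝ) 1, m * N (y - x) ^ 2 ≤ h𝔉 (x + t • (y - x)) (y - x)

/-- ML's TANGENT form ⇒ the segment form: if differences of chart points lie in a set `T` ("tangent space",
(83): QW = 0, RD*W = 0 — the case B = 0 of (75)) and `Hess 𝔉(z)[W, W] ≥ m N(W)²` for every chart point `z` and every
`W ∈ T`, then `StrongSecondVariation K h𝔉 N m` (chart points of a segment stay in the convex chart). [folklore] -/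
theorem strongSecondVariation_of_tangent {K T : Set E} {h𝔉 : E → E → ℝ} {N : E → ℝ} {m : ℝ}
    (hK : Convex ℝ K) (hT : ∀ x ∈ K, ∀ y ∈ K, y - x ∈ T)
    (hML : ∀ z ∈ K, ∀ W ∈ T, m * N W ^ 2 ≤ h𝔉 z W) : StrongSecondVariation K h𝔉 N m :=
  fun x hx y hy _ ht => hML _ (hK.add_smul_sub_mem hx hy ht) _ (hT x hx y hy)

/-- CONSISTENCY WITH THE CELL'S GLOBAL-MINIMUM READING: the SAME hypothesis package — `ChartC2` and
`StrongSecondVariation … N m` with `m ≥ 0` — gives `B11GlobalMin.ChartConvex K 𝔉` (= `ConvexOn ℝ K 𝔉`, the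
hypothesis of `B11GlobalMin.globalMin_of_chart`) through `B11HessianL2.chartConvex_of_second_variation`; so one
supplied lemma (ML) serves both the global-minimum reading and the response bound of this module. [folklore] -/
theorem chartConvex_of_strongSecondVariation {K : Set E} {𝔉 : E → ℝ} {d𝔉 : E → E →ₗ[ℝ] ℝ} {h𝔉 : E → E → ℝ}
    {N : E → ℝ} {m : ℝ} (hC : ChartC2 K 𝔉 d𝔉 h𝔉) (hS : StrongSecondVariation K h𝔉 N m) (hm : 0 ≤ m) :
    B11GlobalMin.ChartConvex K 𝔉 := by
  refine B11HessianL2.chartConvex_of_second_variation hC.convex ?_ ?_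
  · intro x hx y hy
    have hd := hC.hasDeriv x hx y hy
    have hd2 := hC.hasDeriv2 x hx y hy
    refine ⟨fun t ht => (hd t ht).continuousAt.continuousWithinAt,
      fun t ht => (hd t (Ioo_subset_Icc_self ht)).differentiableAt.differentiableWithinAt, ?_⟩
    have heq : EqOn (deriv (fun s : ℝ => 𝔉 (x + s • (y - x)))) (fun s => d𝔉 (x + s • (y - x)) (y - x))
        (Ioo (0:ℝ) 1) := fun t ht => (hd t (Ioo_subset_Icc_self ht)).deriv
    have hdiff : DifferentiableOn ℝ (fun s : ℝ => d𝔉 (x + s • (y - x)) (y - x)) (Ioo (0:ℝ) 1) :=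
      fun t ht => (hd2 t (Ioo_subset_Icc_self ht)).differentiableAt.differentiableWithinAt
    exact hdiff.congr heq
  · intro x hx y hy t ht
    have hd := hC.hasDeriv x hx y hy
    have hd2 := hC.hasDeriv2 x hx y hy
    show 0 ≤ deriv (deriv (fun s : ℝ => 𝔉 (x + s • (y - x)))) t
    have hev : deriv (fun s : ℝ => 𝔉 (x + s • (y - x))) =ᶠ[𝓝 t] (fun s => d𝔉 (x + s • (y - x)) (y - x)) := by
      filter_upwards [Ioo_mem_nhds ht.1 ht.2] with s hs
      exact (hd s (Ioo_subset_Icc_self hs)).deriv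
    rw [hev.deriv_eq, (hd2 t (Ioo_subset_Icc_self ht)).deriv]
    exact (mul_nonneg hm (sq_nonneg (N (y - x)))).trans (hS x hx y hy t (Ioo_subset_Icc_self ht))

/-- VARIATIONAL INEQUALITY at a constrained minimiser: if `x*` minimises `𝔉` on the convex chart `K` then
`D𝔉(x*)[w − x*] ≥ 0` for every `w ∈ K` (for Bałaban's A′* and B = 0 this is the printed criticality (82)–(83),
even with equality). [folklore] -/
theorem variationalIneq_of_isMinOn {K : Set E} {𝔉 : E → ℝ} {d𝔉 : E → E →ₗ[ℝ] ℝ} {h𝔉 : E → E → ℝ}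
    (hC : ChartC2 K 𝔉 d𝔉 h𝔉) {xs w : E} (hxs : xs ∈ K) (hw : w ∈ K) (hmin : IsMinOn 𝔉 K xs) :
    0 ≤ d𝔉 xs (w - xs) := by
  have h0 : (0:ℝ) ∈ Icc (0:ℝ) 1 := by simp
  have hD := hC.hasDeriv xs hxs w hw 0 h0
  simp only [zero_smul, add_zero] at hD
  refine deriv_nonneg_of_isMinOn_segment hD ?_
  intro t ht
  have hmem : xs + t • (w - xs) ∈ K := hC.convex.add_smul_sub_mem hxs hw (Ioo_subset_Icc_self ht)
  simpa using hmin hmem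

/-- **ENERGY RESPONSE (strict convexity ⇒ Lipschitz response with modulus 1/m).**  On a convex chart carrying a
`ChartC2` functional with `StrongSecondVariation … N m`, `m > 0`: if `x* ∈ K` satisfies the variational inequality
in the direction of a competitor `w ∈ K` and the competitor's RESIDUAL in that direction is bounded in the dual
energy norm, `D𝔉(w)[w − x*] ≤ r · N(w − x*)` with `r ≥ 0`, then `N(w − x*) ≤ r / m`.  Dictionary (module
docstring): w = 0 = "the block-averaged finer minimiser as background", x* = A′*, r = the dual energy norm of
⟨J, ·⟩ on T, 1/m = 2/c_*.  [folklore] -/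
theorem response_of_strongConvexity {K : Set E} {𝔉 : E → ℝ} {d𝔉 : E → E →ₗ[ℝ] ℝ} {h𝔉 : E → E → ℝ}
    {N : E → ℝ} {m r : ℝ} (hC : ChartC2 K 𝔉 d𝔉 h𝔉) (hS : StrongSecondVariation K h𝔉 N m) (hm : 0 < m)
    (hN : ∀ v, 0 ≤ N v) {xs w : E} (hxs : xs ∈ K) (hw : w ∈ K) (hVI : 0 ≤ d𝔉 xs (w - xs)) (hr : 0 ≤ r)
    (hres : d𝔉 w (w - xs) ≤ r * N (w - xs)) : N (w - xs) ≤ r / m := by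
  set n := N (w - xs) with hn
  have h0 : (0:ℝ) ∈ Icc (0:ℝ) 1 := by simp
  have h1 : (1:ℝ) ∈ Icc (0:ℝ) 1 := by simp
  have key := slope_lower (hC.hasDeriv2 xs hxs w hw) (fun t ht => hS xs hxs w hw t ht) h0 h1 zero_le_one
  simp only [zero_smul, add_zero, one_smul, add_sub_cancel, sub_zero, mul_one] at key
  -- key : m * n ^ 2 ≤ d𝔉 w (w - xs) - d𝔉 xs (w - xs)
  have hmn : m * n ^ 2 ≤ r * n := by linarith
  rcases (hN (w - xs)).eq_or_lt with hz | hpos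
  · have hz' : n = 0 := by rw [hn]; exact hz.symm
    rw [hz']; positivity
  · rw [le_div_iff₀ hm]
    have : m * n * n ≤ r * n := by nlinarith
    have := le_of_mul_le_mul_right this hpos
    linarith

/-- The same with the variational inequality discharged by MINIMALITY of `x*` on `K` ([Balaban1985Variational]
Thm 1 gives a minimal orbit; in the chart, A′* minimises 𝔉 on K — this is where the cell's global-minimum reading
`B11GlobalMin` would enter; only the VI in the one direction `w − x*` is used). [folklore] -/
theorem response_of_isMinOn {K : Set E} {𝔉 : E → ℝ} {d𝔉 : E → E →ₗ[ℝ] ℝ} {h𝔉 : E → E → ℝ}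
    {N : E → ℝ} {m r : ℝ} (hC : ChartC2 K 𝔉 d𝔉 h𝔉) (hS : StrongSecondVariation K h𝔉 N m) (hm : 0 < m)
    (hN : ∀ v, 0 ≤ N v) {xs w : E} (hxs : xs ∈ K) (hw : w ∈ K) (hmin : IsMinOn 𝔉 K xs) (hr : 0 ≤ r)
    (hres : d𝔉 w (w - xs) ≤ r * N (w - xs)) : N (w - xs) ≤ r / m :=
  response_of_strongConvexity hC hS hm hN hxs hw (variationalIneq_of_isMinOn hC hxs hw hmin) hr hres

/-! ## §3 The action gap and the two-data form -/

/-- ACTION GAP, lower half: `𝔉 w − 𝔉 x* ≥ (m/2) N(w − x*)²` (quadratic growth away from the constrained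
minimiser).  Dictionary: 𝔉 0 − 𝔉 A′* = A^η(W_k(V)) − A^η(U_k(V)) ≥ 0 with a quadratic lower bound. [folklore] -/
theorem actionGap_lower {K : Set E} {𝔉 : E → ℝ} {d𝔉 : E → E →ₗ[ℝ] ℝ} {h𝔉 : E → E → ℝ}
    {N : E → ℝ} {m : ℝ} (hC : ChartC2 K 𝔉 d𝔉 h𝔉) (hS : StrongSecondVariation K h𝔉 N m)
    {xs w : E} (hxs : xs ∈ K) (hw : w ∈ K) (hVI : 0 ≤ d𝔉 xs (w - xs)) :
    m / 2 * N (w - xs) ^ 2 ≤ 𝔉 w - 𝔉 xs := by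
  have key := taylor_lower (hC.hasDeriv xs hxs w hw) (hC.hasDeriv2 xs hxs w hw)
    (fun t ht => hS xs hxs w hw t ht)
  simp only [zero_smul, add_zero, one_smul, add_sub_cancel] at key
  linarith

/-- ACTION GAP, upper half: with the residual bound `D𝔉(w)[w − x*] ≤ r N(w − x*)`, `𝔉 w − 𝔉 x* ≤ r²/(2m)` — the
action reading carries the SQUARE of the dual residual (so its rate is θ², cf. `actionGap_rate`). [folklore] -/
theorem actionGap_upper {K : Set E} {𝔉 : E → ℝ} {d𝔉 : E → E →ₗ[ℝ] ℝ} {h𝔉 : E → E → ℝ}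
    {N : E → ℝ} {m r : ℝ} (hC : ChartC2 K 𝔉 d𝔉 h𝔉) (hS : StrongSecondVariation K h𝔉 N m) (hm : 0 < m)
    {xs w : E} (hxs : xs ∈ K) (hw : w ∈ K) (hres : d𝔉 w (w - xs) ≤ r * N (w - xs)) :
    𝔉 w - 𝔉 xs ≤ r ^ 2 / (2 * m) := by
  have key := taylor_upper (hC.hasDeriv xs hxs w hw) (hC.hasDeriv2 xs hxs w hw)
    (fun t ht => hS xs hxs w hw t ht)
  simp only [zero_smul, add_zero, one_smul, add_sub_cancel] at key
  set n := N (w - xs)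
  -- 𝔉 w − 𝔉 xs ≤ r n − m n²/2 ≤ r²/(2m)
  have h1 : 𝔉 w - 𝔉 xs ≤ r * n - m * n ^ 2 / 2 := by linarith
  have h2 : r * n - m * n ^ 2 / 2 ≤ r ^ 2 / (2 * m) := by
    rw [le_div_iff₀ (by positivity)]
    nlinarith [sq_nonneg (r - m * n)]
  linarith

/-- TWO-DATA LIPSCHITZ FORM: two functionals on the same convex chart — `𝔉₁`, a `ChartC2` functional with
`StrongSecondVariation … N m`, and a second one entering only through its first variation `d𝔉₂` —; if `x₁*`
satisfies the VI for `𝔉₁` towards `x₂*`, `x₂*` the VI for the second functional towards `x₁*`, and the DIFFERENCE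
of the first variations at `x₂*` is `≤ δ N(x₂* − x₁*)` in the direction `x₂* − x₁*`, then `N(x₂* − x₁*) ≤ δ/m` (Lipschitz dependence of the constrained minimiser on the data — two backgrounds, two V's —
with explicit modulus 1/m).  NOT printed for Bałaban's minimisers (the printed dependence is analyticity, Prop. 9
p. 309, without a modulus). [folklore] -/
theorem twoData_response {K : Set E} {𝔉₁ : E → ℝ} {d𝔉₁ d𝔉₂ : E → E →ₗ[ℝ] ℝ} {h𝔉₁ : E → E → ℝ}
    {N : E → ℝ} {m δ : ℝ} (hC₁ : ChartC2 K 𝔉₁ d𝔉₁ h𝔉₁) (hS₁ : StrongSecondVariation K h𝔉₁ N m)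
    (hm : 0 < m) (hN : ∀ v, 0 ≤ N v) {x₁ x₂ : E} (hx₁ : x₁ ∈ K) (hx₂ : x₂ ∈ K)
    (hVI₁ : 0 ≤ d𝔉₁ x₁ (x₂ - x₁)) (hVI₂ : 0 ≤ d𝔉₂ x₂ (x₁ - x₂)) (hδ : 0 ≤ δ)
    (hdiff : d𝔉₁ x₂ (x₂ - x₁) - d𝔉₂ x₂ (x₂ - x₁) ≤ δ * N (x₂ - x₁)) : N (x₂ - x₁) ≤ δ / m := by
  refine response_of_strongConvexity hC₁ hS₁ hm hN hx₁ hx₂ hVI₁ hδ ?_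
  have hneg : d𝔉₂ x₂ (x₁ - x₂) = -(d𝔉₂ x₂ (x₂ - x₁)) := by
    rw [← map_neg, neg_sub]
  linarith [hneg ▸ hVI₂]

end Chart

/-! ## §4 The residual-pairing identity (why the energy route has a rate) -/

section Pairing

variable {E F : Type*} [AddCommGroup E] [Module ℝ E] [AddCommGroup F] [Module ℝ F]

/-- RESIDUAL PAIRING (linear bookkeeping).  Coarse action `𝒜c : E → ℝ` with first variation `d𝒜c`, fine action
`𝒜f : F → ℝ` with `d𝒜f`, a (nonlinear) averaging `P : F → E` with linearisation `dP u`, and the one-step ACTION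
DEFECT `𝓓 = 𝒜c ∘ P − 𝒜f` with the chain rule for its first variation (hypothesis `hchain`).  If `u` is critical
for `𝒜f` in the fine tangent direction `ψ` and `ψ` LIFTS the coarse direction `φ` (`dP u ψ = φ`), then the coarse
residual of the averaged field pairs as `D𝒜c(P u)[φ] = D𝓓(u)[ψ]`.  Dictionary: u = U_{k+1}(V), P u = W_k(V),
D𝒜c(P u)[φ] = ⟨J(W_k(V)), φ⟩ by (26)–(27). [folklore] [cite: Balaban1985Variational, (26)–(27) p. 282] -/
theorem residual_pairing (d𝒜c : E → E →ₗ[ℝ] ℝ) (d𝒜f : F → F →ₗ[ℝ] ℝ) (P : F → E) (dP : F → F →ₗ[ℝ] E)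
    (d𝓓 : F → F →ₗ[ℝ] ℝ) (hchain : ∀ u ψ, d𝓓 u ψ = d𝒜c (P u) (dP u ψ) - d𝒜f u ψ)
    {u ψ : F} {φ : E} (hcrit : d𝒜f u ψ = 0) (hlift : dP u ψ = φ) : d𝒜c (P u) φ = d𝓓 u ψ := by
  rw [hchain, hcrit, hlift, sub_zero]

/-- HYPOTHESIS SHAPE (the typed MISSING INEQUALITY of the energy route, R2^E; NOT printed): a bound for the first
variation of the one-step action defect at the fine critical fields, `|D𝓓(u)[ψ]| ≤ δ · ‖ψ‖_F` for `u ∈ crit`, in a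
fine energy-type norm `normF`.  Intended: δ = δ_k = C ε₁ · η_k^γ from a ZEROTH-order-in-the-field pointwise
consistency of "average then coarse plaquette" versus "fine plaquettes" for (9)ˢᵘᵖ+(10)-regular fields (rate γ = 1 from
the L²-control of ∇F that the printed sup bounds (9)ˢᵘᵖ (|A|, |∇^ηA|) and (10) (|∂^{η*}∂^ηA|, |Δ^ηA|) give via interior
H² regularity, §4c; the Hölder clause (9) at its printed endpoint β₀ = 1 is NOT used — the cell's B11 lineage located
it as underived in print (GAPS G-B11-F3a, HOLDER-9 (R1)); record §3.8 / Appendix β).  Never used as a fact.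
[cite: Balaban1985Variational, Thm 1 (9) sup entries, (10) p. 279 (uniform regularity; the defect bound itself is not printed)] -/
def DefectDerivBound (crit : Set F) (d𝓓 : F → F →ₗ[ℝ] ℝ) (normF : F → ℝ) (δ : ℝ) : Prop :=
  ∀ u ∈ crit, ∀ ψ : F, |d𝓓 u ψ| ≤ δ * normF ψ

/-- HYPOTHESIS SHAPE (lift of coarse tangent directions; NOT printed as such): every coarse tangent direction
`φ ∈ T` has a fine direction `ψ`, tangent to the fine constraints at `u` (`fineT u ψ`), with `dP u ψ = φ` and
`‖ψ‖_F ≤ Λ N(φ)`.  Intended: the piecewise-constant lift under the linearised averaging Q (cost: the full gradient of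
φ, via a lattice Gaffney identity and the gauge condition (76)), or a Whitney-type lift. Never used as a fact.
[cite: Balaban1985Variational, (75)–(76) p. 289, (83) p. 290 (the constraint and gauge conditions being lifted)] -/
def TangentLift (crit : Set F) (T : Set E) (fineT : F → F → Prop) (dP : F → F →ₗ[ℝ] E) (normF : F → ℝ)
    (N : E → ℝ) (Λ : ℝ) : Prop :=
  ∀ u ∈ crit, ∀ φ ∈ T, ∃ ψ : F, fineT u ψ ∧ dP u ψ = φ ∧ normF ψ ≤ Λ * N φ

/-- R2^E REDUCED: under the chain rule, fine criticality on fine tangent directions, `TangentLift … Λ` and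
`DefectDerivBound … δ` (δ ≥ 0), the coarse residual of the averaged critical field is small in the DUAL ENERGY NORM
on T: `|D𝒜c(P u)[φ]| ≤ Λ δ N(φ)` for `φ ∈ T` — i.e. the `r` of `response_of_strongConvexity` is `≤ Λ δ`. [folklore] -/
theorem dualResidual_le {crit : Set F} {T : Set E} {fineT : F → F → Prop} (d𝒜c : E → E →ₗ[ℝ] ℝ)
    (d𝒜f : F → F →ₗ[ℝ] ℝ) (P : F → E) (dP : F → F →ₗ[ℝ] E) (d𝓓 : F → F →ₗ[ℝ] ℝ) {normF : F → ℝ}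
    {N : E → ℝ} {Λ δ : ℝ} (hchain : ∀ u ψ, d𝓓 u ψ = d𝒜c (P u) (dP u ψ) - d𝒜f u ψ)
    (hcrit : ∀ u ∈ crit, ∀ ψ, fineT u ψ → d𝒜f u ψ = 0)
    (hlift : TangentLift crit T fineT dP normF N Λ) (hdef : DefectDerivBound crit d𝓓 normF δ) (hδ : 0 ≤ δ)
    {u : F} (hu : u ∈ crit) {φ : E} (hφ : φ ∈ T) : |d𝒜c (P u) φ| ≤ Λ * δ * N φ := by
  obtain ⟨ψ, hT, hPψ, hnorm⟩ := hlift u hu φ hφ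
  rw [residual_pairing d𝒜c d𝒜f P dP d𝓓 hchain (hcrit u hu ψ hT) hPψ]
  calc |d𝓓 u ψ| ≤ δ * normF ψ := hdef u hu ψ
    _ ≤ δ * (Λ * N φ) := mul_le_mul_of_nonneg_left hnorm hδ
    _ = Λ * δ * N φ := by ring

/-- THE SOURCE OF THE RATE, linearised model (kernel of the record's §3 computation "S*S F − F = O(η·Lip F)"):
a non-negative stencil `w p ·` with unit mass, supported within distance `ρ` of `p`, reproduces a function `F` up
to `Lip(F) · ρ` pointwise.  Intended: `w` = S*S (spread ∘ collect of fine plaquettes under one block-averaging step,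
width ρ ≍ η), `F` = the fine minimiser's curvature at unit scale — giving the defect size δ ≍ Lip(F) · η, i.e. rate
θ_E = L^{−1} in the linearised model IF Lip(F) ≲ ε₁.  CAVEAT (v1.4): this SUP form needs a k-uniform Lipschitz bound
on F, i.e. the Hölder clause (9) at β₀ = 1, which print states but does not derive (cell GAPS G-B11-F3a / HOLDER-9
(R1): derivable for β₀ < 1 only, giving ρ^{β₀} here); the energy route therefore uses the L² form
`stencil_L2_defect_le_variance` + `telescope_sq_le` (§4c), whose input ‖∇F‖_{L²_loc} ≲ ε₁ comes from the printed
sup bounds (9)ˢᵘᵖ and (10) via interior H² regularity — same rate θ_E = L^{−1}. [folklore]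
[cite: Balaban1985Variational, Thm 1 (9) sup entries, (10) p. 279 (the regularity type; the consistency bound is not printed)] -/
theorem stencil_consistency {P : Type*} [Fintype P] (w dist : P → P → ℝ) (F : P → ℝ) {ρ ΛF : ℝ}
    (hw0 : ∀ p q, 0 ≤ w p q) (hw1 : ∀ p, ∑ q, w p q = 1) (hloc : ∀ p q, w p q ≠ 0 → dist p q ≤ ρ)
    (hF : ∀ p q, |F q - F p| ≤ ΛF * dist p q) (hΛ : 0 ≤ ΛF) (p : P) :
    |∑ q, w p q * F q - F p| ≤ ΛF * ρ := by
  have h1 : ∑ q, w p q * F q - F p = ∑ q, w p q * (F q - F p) := by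
    simp only [mul_sub, Finset.sum_sub_distrib, ← Finset.sum_mul, hw1, one_mul]
  rw [h1]
  have hterm : ∀ q, |w p q * (F q - F p)| ≤ w p q * (ΛF * ρ) := by
    intro q
    rw [abs_mul, abs_of_nonneg (hw0 p q)]
    by_cases h : w p q = 0
    · simp [h]
    · exact mul_le_mul_of_nonneg_left ((hF p q).trans (mul_le_mul_of_nonneg_left (hloc p q h) hΛ)) (hw0 p q)
  calc |∑ q, w p q * (F q - F p)| ≤ ∑ q, |w p q * (F q - F p)| := Finset.abs_sum_le_sum_abs _ _
    _ ≤ ∑ q, w p q * (ΛF * ρ) := Finset.sum_le_sum fun q _ => hterm q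
    _ = ΛF * ρ := by rw [← Finset.sum_mul, hw1, one_mul]

/-- THE SOURCE OF THE RATE FOR THE ACTION READING, linearised model: for a unit-mass stencil `w` that is
REVERSIBLE with respect to site weights `m` (`m p · w p q = m q · w q p` — e.g. `w` = S*S, `m` = the lattice cell
volumes), the energy defect `Σ m F (F − wF)` (= ‖F‖² − ‖SF‖² for `w` = S*S) is HALF THE `m·w`-WEIGHTED VARIANCE of
`F`.  With `stencil_energyDefect_le` below: ≤ ½ (Lip F · ρ)² · Σ m — two powers of the width ρ ≍ η, i.e. the defect
VALUE 𝓓(U_{k+1}) = A^η(avg U_{k+1}) − A^{η/L}(U_{k+1}) is O(ε₁² η² |T₁|): rate θ = L^{−2} for the action reading in the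
linearised model. [folklore] -/
theorem stencil_energyDefect_eq {P : Type*} [Fintype P] (m : P → ℝ) (w : P → P → ℝ) (F : P → ℝ)
    (hw1 : ∀ p, ∑ q, w p q = 1) (hsym : ∀ p q, m p * w p q = m q * w q p) :
    ∑ p, m p * F p * (F p - ∑ q, w p q * F q) = (1 / 2) * ∑ p, ∑ q, m p * w p q * (F p - F q) ^ 2 := by
  have h1 : ∀ p, F p - ∑ q, w p q * F q = ∑ q, w p q * (F p - F q) := by
    intro p; simp only [mul_sub, Finset.sum_sub_distrib, ← Finset.sum_mul, hw1, one_mul]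
  have h3 : ∑ p, ∑ q, m p * w p q * F q ^ 2 = ∑ p, ∑ q, m p * w p q * F p ^ 2 := by
    rw [Finset.sum_comm]
    refine Finset.sum_congr rfl (fun p _ => Finset.sum_congr rfl (fun q _ => ?_))
    rw [hsym q p]
  have hL : ∑ p, m p * F p * (F p - ∑ q, w p q * F q)
      = ∑ p, ∑ q, m p * w p q * F p ^ 2 - ∑ p, ∑ q, m p * w p q * (F p * F q) := by
    rw [← Finset.sum_sub_distrib]
    refine Finset.sum_congr rfl (fun p _ => ?_)
    rw [h1 p, Finset.mul_sum, ← Finset.sum_sub_distrib]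
    refine Finset.sum_congr rfl (fun q _ => ?_)
    ring
  have hR : ∑ p, ∑ q, m p * w p q * (F p - F q) ^ 2
      = ∑ p, ∑ q, m p * w p q * F p ^ 2 - 2 * ∑ p, ∑ q, m p * w p q * (F p * F q)
        + ∑ p, ∑ q, m p * w p q * F q ^ 2 := by
    rw [Finset.mul_sum, ← Finset.sum_sub_distrib, ← Finset.sum_add_distrib]
    refine Finset.sum_congr rfl (fun p _ => ?_)
    rw [Finset.mul_sum, ← Finset.sum_sub_distrib, ← Finset.sum_add_distrib]
    refine Finset.sum_congr rfl (fun q _ => ?_)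
    ring
  rw [hL, hR, h3]
  ring

/-- … and the weighted variance of `F` over a stencil of width `ρ` is at most `(Lip F · ρ)² · (total mass)`; with
`stencil_energyDefect_eq`: energy defect ≤ ½ (Lip F · ρ)² Σ m. [folklore] -/
theorem stencil_energyDefect_le {P : Type*} [Fintype P] (m : P → ℝ) (w dist : P → P → ℝ) (F : P → ℝ)
    {ρ ΛF : ℝ} (hm : ∀ p, 0 ≤ m p) (hw0 : ∀ p q, 0 ≤ w p q) (hw1 : ∀ p, ∑ q, w p q = 1)
    (hloc : ∀ p q, w p q ≠ 0 → dist p q ≤ ρ) (hF : ∀ p q, |F q - F p| ≤ ΛF * dist p q) (hΛ : 0 ≤ ΛF)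
    (hρ : 0 ≤ ρ) :
    (1 / 2) * ∑ p, ∑ q, m p * w p q * (F p - F q) ^ 2 ≤ (1 / 2) * (ΛF * ρ) ^ 2 * ∑ p, m p := by
  have hterm : ∀ p q, m p * w p q * (F p - F q) ^ 2 ≤ m p * w p q * (ΛF * ρ) ^ 2 := by
    intro p q
    by_cases h : w p q = 0
    · simp [h]
    · refine mul_le_mul_of_nonneg_left ?_ (mul_nonneg (hm p) (hw0 p q))
      have hb : |F p - F q| ≤ ΛF * ρ := by
        rw [abs_sub_comm]; exact (hF p q).trans (mul_le_mul_of_nonneg_left (hloc p q h) hΛ)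
      have hb0 : 0 ≤ ΛF * ρ := mul_nonneg hΛ hρ
      calc (F p - F q) ^ 2 = |F p - F q| ^ 2 := (sq_abs _).symm
        _ ≤ (ΛF * ρ) ^ 2 := pow_le_pow_left₀ (abs_nonneg _) hb 2
  have hsum : ∑ p, ∑ q, m p * w p q * (F p - F q) ^ 2 ≤ ∑ p, m p * (ΛF * ρ) ^ 2 := by
    refine Finset.sum_le_sum (fun p _ => ?_)
    calc ∑ q, m p * w p q * (F p - F q) ^ 2 ≤ ∑ q, m p * w p q * (ΛF * ρ) ^ 2 :=
          Finset.sum_le_sum (fun q _ => hterm p q)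
      _ = m p * (ΛF * ρ) ^ 2 := by
          rw [← Finset.sum_mul, ← Finset.mul_sum, hw1, mul_one]
  calc (1 / 2) * ∑ p, ∑ q, m p * w p q * (F p - F q) ^ 2 ≤ (1 / 2) * ∑ p, m p * (ΛF * ρ) ^ 2 :=
        mul_le_mul_of_nonneg_left hsum (by norm_num)
    _ = (1 / 2) * (ΛF * ρ) ^ 2 * ∑ p, m p := by rw [← Finset.sum_mul]; ring

/-- SECOND-ORDER STENCIL CONSISTENCY (the centred case). If the non-negative unit-mass stencil `w` of width `ρ`
annihilates the LINEAR PART `ℓ p q` of `F` around each point (`Σ_q w p q · ℓ p q = 0`: zero first moment — for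
`w` = S*S, S the curvature stencil of the linearised line-average block operator (d_η ∘ Q = S ∘ d_{η/L}), this holds
EXACTLY: S*S reproduces affine functions, by Hermite's identity Σ_{i<L} ⌊(n − i)/L⌋ = n − L + 1; record
HOME/t4/T4-EST-NE3-P2.md §3.6, toy check) and `F` obeys the second-order Taylor bound
`|F q − F p − ℓ p q| ≤ (Λ₂/2) · dist p q ²`, then `|(wF)(p) − F(p)| ≤ (Λ₂/2) ρ²` — TWO powers of the width (rate
θ_E = L^{−2} for C² fine curvature in the linearised model).  Bałaban's minimisers are H¹-regular in the curvature at
the unit scale (∇F ∈ L²_loc from the printed (9)ˢᵘᵖ + (10), §4c), for which the ONE-power L² consistency is what applies;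
see `weightedSq_split` for the mixed L² rate of the toy. [folklore] -/
theorem stencil_consistency2 {P : Type*} [Fintype P] (w dist ℓ : P → P → ℝ) (F : P → ℝ) {ρ Λ₂ : ℝ}
    (hw0 : ∀ p q, 0 ≤ w p q) (hw1 : ∀ p, ∑ q, w p q = 1) (hloc : ∀ p q, w p q ≠ 0 → dist p q ≤ ρ)
    (hd : ∀ p q, 0 ≤ dist p q) (hcent : ∀ p, ∑ q, w p q * ℓ p q = 0)
    (hF : ∀ p q, |F q - F p - ℓ p q| ≤ Λ₂ / 2 * dist p q ^ 2) (hΛ : 0 ≤ Λ₂) (p : P) :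
    |∑ q, w p q * F q - F p| ≤ Λ₂ / 2 * ρ ^ 2 := by
  have h1 : ∑ q, w p q * (F q - F p - ℓ p q) = ∑ q, w p q * F q - F p := by
    calc ∑ q, w p q * (F q - F p - ℓ p q) = ∑ q, (w p q * F q - w p q * F p - w p q * ℓ p q) := by
          refine Finset.sum_congr rfl (fun q _ => by ring)
      _ = ∑ q, w p q * F q - (∑ q, w p q) * F p - ∑ q, w p q * ℓ p q := by
          rw [Finset.sum_sub_distrib, Finset.sum_sub_distrib, Finset.sum_mul]
      _ = ∑ q, w p q * F q - F p := by rw [hw1, hcent]; ring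
  rw [← h1]
  have hterm : ∀ q, |w p q * (F q - F p - ℓ p q)| ≤ w p q * (Λ₂ / 2 * ρ ^ 2) := by
    intro q
    rw [abs_mul, abs_of_nonneg (hw0 p q)]
    by_cases h : w p q = 0
    · simp [h]
    · refine mul_le_mul_of_nonneg_left ((hF p q).trans ?_) (hw0 p q)
      have hdρ : dist p q ^ 2 ≤ ρ ^ 2 := pow_le_pow_left₀ (hd p q) (hloc p q h) 2
      exact mul_le_mul_of_nonneg_left hdρ (by positivity)
  calc |∑ q, w p q * (F q - F p - ℓ p q)| ≤ ∑ q, |w p q * (F q - F p - ℓ p q)| :=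
        Finset.abs_sum_le_sum_abs _ _
    _ ≤ ∑ q, w p q * (Λ₂ / 2 * ρ ^ 2) := Finset.sum_le_sum fun q _ => hterm q
    _ = Λ₂ / 2 * ρ ^ 2 := by rw [← Finset.sum_mul, hw1, one_mul]

/-- L² SPLIT OVER A LAYER SET (why the linearised toy rate in L² is 3/2, T4-RUNG-U1b1 §4 / record §3.6). If `|g| ≤ a`
on a layer set `K` (the ρ-neighbourhood of the unit-block faces, where the fine curvature is only Lipschitz:
`a` = Lip F · ρ by `stencil_consistency`) and `|g| ≤ b` off `K` (`b` = (Λ₂/2) ρ²` by `stencil_consistency2`), then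
`Σ m g² ≤ a² · m(K) + b² · m(all)`.  With m(K) ≍ ρ · m(all) (a layer of thickness ρ per unit block):
‖(S*S − 1)F‖²_{L²} ≲ (Lip F)² ρ³ + Λ₂² ρ⁴ per unit volume — L²-rate ρ^{3/2}; in the full model this needs a
PIECEWISE-C² structure of the minimiser's curvature across block faces, which (9)–(10) do not print as such (the
H¹-control of the curvature from (9)ˢᵘᵖ + (10) gives the L²-rate ρ¹, §4c). [folklore] -/
theorem weightedSq_split {P : Type*} [Fintype P] [DecidableEq P] (m g : P → ℝ) (K : Finset P) {a b : ℝ}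
    (hm : ∀ p, 0 ≤ m p) (ha : ∀ p ∈ K, |g p| ≤ a) (hb : ∀ p ∉ K, |g p| ≤ b) :
    ∑ p, m p * g p ^ 2 ≤ a ^ 2 * ∑ p ∈ K, m p + b ^ 2 * ∑ p, m p := by
  have hsplit : ∑ p, m p * g p ^ 2 = ∑ p ∈ K, m p * g p ^ 2 + ∑ p ∈ Kᶜ, m p * g p ^ 2 :=
    (Finset.sum_add_sum_compl K _).symm
  have hsq : ∀ p c, |g p| ≤ c → g p ^ 2 ≤ c ^ 2 := by
    intro p c hc
    calc g p ^ 2 = |g p| ^ 2 := (sq_abs _).symm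
      _ ≤ c ^ 2 := pow_le_pow_left₀ (abs_nonneg _) hc 2
  have hK : ∑ p ∈ K, m p * g p ^ 2 ≤ a ^ 2 * ∑ p ∈ K, m p := by
    rw [Finset.mul_sum]
    refine Finset.sum_le_sum (fun p hp => ?_)
    calc m p * g p ^ 2 ≤ m p * a ^ 2 := mul_le_mul_of_nonneg_left (hsq p a (ha p hp)) (hm p)
      _ = a ^ 2 * m p := by ring
  have hKc : ∑ p ∈ Kᶜ, m p * g p ^ 2 ≤ b ^ 2 * ∑ p, m p := by
    calc ∑ p ∈ Kᶜ, m p * g p ^ 2 ≤ ∑ p ∈ Kᶜ, m p * b ^ 2 := by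
          refine Finset.sum_le_sum (fun p hp => ?_)
          exact mul_le_mul_of_nonneg_left (hsq p b (hb p (Finset.mem_compl.mp hp))) (hm p)
      _ ≤ ∑ p, m p * b ^ 2 := by
          refine Finset.sum_le_sum_of_subset_of_nonneg (Finset.subset_univ _) (fun p _ _ => ?_)
          exact mul_nonneg (hm p) (sq_nonneg b)
      _ = b ^ 2 * ∑ p, m p := by rw [← Finset.sum_mul]; ring
  rw [hsplit]
  exact add_le_add hK hKc

end Pairing

/-! ## §4b Dressed (non-abelian) forms of the stencil lemmas — the kernel of the record's Appendix β

In the second-order expansion of Bałaban's one-step averaging (B4 = CMP **98** (1985) p. 19 (15): «Ū_c = exp[i Σ_{x∈B(c₋)}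
L^{−d} (1/i) log U(Γ_{c,x}) U(c)^{−1}] U(c)», read on the render; record Appendix β) around a small field with
covariantly-Lipschitz plaquette field `F`, the coarse plaquette field is a SIGNED unit-mass finite-range stencil of
parallel-transported ("dressed") fine values, `F̄(P) = Σ_q σ(P,q) · Ad_{U(γ_{P,q})} F(q) + O(ε₁² η²)`, the closed-loop
structure of (15) making every other contribution second order.  The printed sup bounds (9)ˢᵘᵖ, (10) of B11 Thm 1 give
(via interior H², §4c) an L²_loc bound on the COVARIANT gradient ∇_U F, hence on the dressed differences
`‖Ad_{U(γ)} F(q) − F(p)‖` summed in L² over the stencil (`telescope_sq_le`).  The two identities below carry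
the leading term of the defect DERIVATIVE (pairing of `(stencil − 1)F` with the covariant curl of the perturbation)
and of the defect VALUE; `g q` / `v q` stand for the dressed values seen from the base point, `f` for `F(p)`; `Ad`
being an isometry, norms of dressed values are norms of `F`.  Abstract finite-dimensional algebra, [folklore]; whether
Bałaban's `F̄` has this form with these error sizes is the paper-level content of Appendix β (status [analysis]). -/

section Dressed

variable {V : Type*} [NormedAddCommGroup V]

/-- DRESSED STENCIL CONSISTENCY (vector form of `stencil_consistency`; SIGNED weights of unit mass and total
variation ≤ M): if every dressed value in the support is within `Λ` of `f`, the stencil value is within `M · Λ` of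
`f`.  Intended: σ = the signed plaquette multiplicities of Appendix β §4 (or the non-negative S*S, M = 1),
Λ = the covariant oscillation of F over the stencil (sup form); the L² form actually used by the energy route is
`stencil_L2_defect_le_variance` (§4c) — leading term `C η ‖∇_U F‖_{L²} ‖d_U ψ‖_{L²}` of (β). [folklore]
[cite: Balaban1985Variational, Thm 1 (9) sup entries, (10) p. 279 (the regularity type only; the bound itself is not printed)] -/
theorem stencil_consistency_dressed [NormedSpace ℝ V] {Q : Type*} [Fintype Q] (σ : Q → ℝ) (g : Q → V) (f : V)
    {Λ M : ℝ} (hσ1 : ∑ q, σ q = 1) (hσabs : ∑ q, |σ q| ≤ M) (hg : ∀ q, σ q ≠ 0 → ‖g q - f‖ ≤ Λ)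
    (hΛ : 0 ≤ Λ) : ‖∑ q, σ q • g q - f‖ ≤ M * Λ := by
  have h1 : ∑ q, σ q • g q - f = ∑ q, σ q • (g q - f) := by
    simp only [smul_sub, Finset.sum_sub_distrib, ← Finset.sum_smul, hσ1, one_smul]
  rw [h1]
  have hterm : ∀ q, ‖σ q • (g q - f)‖ ≤ |σ q| * Λ := by
    intro q
    rw [norm_smul, Real.norm_eq_abs]
    by_cases h : σ q = 0
    · simp [h]
    · exact mul_le_mul_of_nonneg_left (hg q h) (abs_nonneg _)
  calc ‖∑ q, σ q • (g q - f)‖ ≤ ∑ q, ‖σ q • (g q - f)‖ := norm_sum_le _ _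
    _ ≤ ∑ q, |σ q| * Λ := Finset.sum_le_sum fun q _ => hterm q
    _ = (∑ q, |σ q|) * Λ := by rw [Finset.sum_mul]
    _ ≤ M * Λ := mul_le_mul_of_nonneg_right hσabs hΛ

/-- JENSEN WITH DEFICIT (vector form of the core of `stencil_energyDefect_eq`; signed unit-mass weights allowed):
`‖Σ σ_q v_q‖² = Σ σ_q ‖v_q‖² − ½ Σ_p Σ_q σ_p σ_q ‖v_p − v_q‖²` in a real inner-product space.  Intended: per coarse
plaquette, σ = S(P,·), v_q = Ad_{U(γ_{P,q})}F(q); summed against the cell volumes with the column sums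
Σ_P (η^d/η′^d) S(P,q) = 1 the first term reproduces ‖F‖² exactly, so the defect VALUE is minus half a dressed
variance, O(η² ‖∇_U F‖²_{L²}) = O(ε₁²η²) per unit volume (Appendix β §5, `telescope_sq_le`). [folklore] -/
theorem jensen_deficit [InnerProductSpace ℝ V] {Q : Type*} [Fintype Q] (σ : Q → ℝ) (v : Q → V)
    (hσ1 : ∑ q, σ q = 1) :
    ‖∑ q, σ q • v q‖ ^ 2
      = ∑ q, σ q * ‖v q‖ ^ 2 - (1 / 2) * ∑ p, ∑ q, σ p * σ q * ‖v p - v q‖ ^ 2 := by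
  have hS : ‖∑ q, σ q • v q‖ ^ 2 = ∑ p, ∑ q, σ p * σ q * inner ℝ (v p) (v q) := by
    rw [← real_inner_self_eq_norm_sq, sum_inner]
    refine Finset.sum_congr rfl (fun p _ => ?_)
    rw [inner_sum]
    refine Finset.sum_congr rfl (fun q _ => ?_)
    rw [real_inner_smul_left, real_inner_smul_right]
    ring
  have hA : ∑ p, ∑ q, σ p * σ q * ‖v p‖ ^ 2 = ∑ p, σ p * ‖v p‖ ^ 2 := by
    refine Finset.sum_congr rfl (fun p _ => ?_)
    have h : ∑ q, σ p * σ q * ‖v p‖ ^ 2 = (σ p * ‖v p‖ ^ 2) * ∑ q, σ q := by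
      rw [Finset.mul_sum]
      exact Finset.sum_congr rfl (fun q _ => by ring)
    rw [h, hσ1, mul_one]
  have hB : ∑ p, ∑ q, σ p * σ q * ‖v q‖ ^ 2 = ∑ q, σ q * ‖v q‖ ^ 2 := by
    rw [Finset.sum_comm]
    refine Finset.sum_congr rfl (fun q _ => ?_)
    have h : ∑ p, σ p * σ q * ‖v q‖ ^ 2 = (σ q * ‖v q‖ ^ 2) * ∑ p, σ p := by
      rw [Finset.mul_sum]
      exact Finset.sum_congr rfl (fun p _ => by ring)
    rw [h, hσ1, mul_one]
  have hR : ∑ p, ∑ q, σ p * σ q * ‖v p - v q‖ ^ 2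
      = ∑ p, ∑ q, σ p * σ q * ‖v p‖ ^ 2 + ∑ p, ∑ q, σ p * σ q * ‖v q‖ ^ 2
        - 2 * ∑ p, ∑ q, σ p * σ q * inner ℝ (v p) (v q) := by
    rw [Finset.mul_sum, ← Finset.sum_add_distrib, ← Finset.sum_sub_distrib]
    refine Finset.sum_congr rfl (fun p _ => ?_)
    rw [Finset.mul_sum, ← Finset.sum_add_distrib, ← Finset.sum_sub_distrib]
    refine Finset.sum_congr rfl (fun q _ => ?_)
    rw [norm_sub_sq_real]
    ring
  rw [hR, hA, hB, hS]
  ring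

/-- … hence for NON-NEGATIVE unit-mass weights the dressed energy `‖Σσ•v‖²` is at most the convex combination
`Σσ‖v‖²` (Jensen; `Ad` isometric ⇒ this is the fine energy redistributed), and the deficit is at most `½ κ²` when all
pairs of dressed values in the support are within `κ` of each other (sup form; the L² form bounds the deficit summed
against cell volumes by C η² ‖∇_U F‖²_{L²} through `telescope_sq_le`): two powers of η for the ACTION reading in the
non-abelian setting, as in `stencil_energyDefect_le`. [folklore] -/
theorem jensen_deficit_le [InnerProductSpace ℝ V] {Q : Type*} [Fintype Q] (σ : Q → ℝ) (v : Q → V) {κ : ℝ}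
    (hσ0 : ∀ q, 0 ≤ σ q) (hσ1 : ∑ q, σ q = 1) (hv : ∀ p q, σ p ≠ 0 → σ q ≠ 0 → ‖v p - v q‖ ≤ κ) :
    0 ≤ ∑ q, σ q * ‖v q‖ ^ 2 - ‖∑ q, σ q • v q‖ ^ 2 ∧
      ∑ q, σ q * ‖v q‖ ^ 2 - ‖∑ q, σ q • v q‖ ^ 2 ≤ (1 / 2) * κ ^ 2 := by
  have hD : ∑ q, σ q * ‖v q‖ ^ 2 - ‖∑ q, σ q • v q‖ ^ 2
      = (1 / 2) * ∑ p, ∑ q, σ p * σ q * ‖v p - v q‖ ^ 2 := by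
    rw [jensen_deficit σ v hσ1]
    ring
  rw [hD]
  have hterm : ∀ p q, σ p * σ q * ‖v p - v q‖ ^ 2 ≤ σ p * σ q * κ ^ 2 := by
    intro p q
    by_cases hp : σ p = 0
    · simp [hp]
    by_cases hq : σ q = 0
    · simp [hq]
    exact mul_le_mul_of_nonneg_left (pow_le_pow_left₀ (norm_nonneg _) (hv p q hp hq) 2)
      (mul_nonneg (hσ0 p) (hσ0 q))
  have hval : ∑ p, ∑ q, σ p * σ q * κ ^ 2 = κ ^ 2 := by
    have h1 : ∀ p, ∑ q, σ p * σ q * κ ^ 2 = σ p * κ ^ 2 := by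
      intro p
      have h : ∑ q, σ p * σ q * κ ^ 2 = (σ p * κ ^ 2) * ∑ q, σ q := by
        rw [Finset.mul_sum]
        exact Finset.sum_congr rfl (fun q _ => by ring)
      rw [h, hσ1, mul_one]
    rw [Finset.sum_congr rfl (fun p _ => h1 p), ← Finset.sum_mul, hσ1, one_mul]
  refine ⟨?_, ?_⟩
  · refine mul_nonneg (by norm_num) (Finset.sum_nonneg fun p _ => Finset.sum_nonneg fun q _ => ?_)
    exact mul_nonneg (mul_nonneg (hσ0 p) (hσ0 q)) (sq_nonneg _)
  · have hsum : ∑ p, ∑ q, σ p * σ q * ‖v p - v q‖ ^ 2 ≤ ∑ p, ∑ q, σ p * σ q * κ ^ 2 :=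
      Finset.sum_le_sum fun p _ => Finset.sum_le_sum fun q _ => hterm p q
    rw [hval] at hsum
    linarith

end Dressed

/-! ## §4c L² forms — the energy route without the Hölder endpoint (9)_{β₀=1}

OBJECTION ACKNOWLEDGED (cell GAPS G-B11-F3a-T4NE3-HOLDER, B11 lineage gen 16, 2026-08-19): versions v1–v1.3 of this
leaf named «(9) with β₀ = 1» (a k-uniform Lipschitz bound on ∇A, hence on the curvature F at the unit scale) as the
printed input of the SUP-form consistency `stencil_consistency`.  B11 Thm 1 p. 279 does print (9) with «0 ≤ β ≤ β₀ = 1»,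
but the cell's B11 lineage located that clause as DERIVABLE only for β₀ < 1 (via [6] Thm 2 (1.36), constant B₂(β₀) ↑ ∞)
and SOURCELESS at β₀ = 1, with numerics against the obvious route (sup of mixed second differences of Δ^{−1}f grows
logarithmically).  The energy route does not need it: it lives in L², and in L² ALL mixed second differences are
controlled by the Laplacian (below), whose sup bound (10) «|∂^{η*}∂^ηA|, |Δ^ηA| < B₃Mε₁(L^jη)^{−3}» IS printed and
derived (p. 305 (169), together with the sup entries |A|, |∇^ηA| of (9) =: (9)ˢᵘᵖ).  Chain (record §3.8): (9)ˢᵘᵖ + (10) ⇒ ‖∇²A‖_{L²(□/2)} ≲ B₃Mε₁|□|^{1/2} (interior H²: the torus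
identity below, or its cutoff form = discrete Caccioppoli, folklore) ⇒ ‖∇_U F‖_{L²_loc} ≲ (B₃M + B₃²M²ε₁)ε₁ ⇒
(`telescope_sq_le`) weighted variance of the dressed values over a stencil of width ρ ≍ η is ≲ η²‖∇_UF‖²_{L²} ⇒
(`stencil_L2_defect_le_variance`, `jensen_deficit`) L² stencil defect ≲ η‖∇_UF‖_{L²} and energy deficit ≲ η²‖∇_UF‖²:
the SAME rates θ_E = L^{−1} (energy distance, global / volume-RMS forms) and L^{−2} (action value) as before, constants
now through B₃ instead of the undefined B₄(1).  Abstract algebra only; [folklore]. -/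

section L2Forms

variable {V : Type*} [NormedAddCommGroup V]

/-- JENSEN for non-negative unit-mass weights in a real inner-product space: `‖Σ σ_q v_q‖² ≤ Σ σ_q ‖v_q‖²`
(from `jensen_deficit`). [folklore] -/
theorem jensen_sq [InnerProductSpace ℝ V] {Q : Type*} [Fintype Q] (σ : Q → ℝ) (v : Q → V)
    (hσ0 : ∀ q, 0 ≤ σ q) (hσ1 : ∑ q, σ q = 1) :
    ‖∑ q, σ q • v q‖ ^ 2 ≤ ∑ q, σ q * ‖v q‖ ^ 2 := by
  have h := jensen_deficit σ v hσ1
  have hnn : 0 ≤ ∑ p, ∑ q, σ p * σ q * ‖v p - v q‖ ^ 2 :=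
    Finset.sum_nonneg fun p _ => Finset.sum_nonneg fun q _ =>
      mul_nonneg (mul_nonneg (hσ0 p) (hσ0 q)) (sq_nonneg _)
  rw [h]
  linarith

/-- L² STENCIL CONSISTENCY IS BOUNDED BY THE WEIGHTED VARIANCE (dressed, vector-valued; NO Lipschitz or Hölder bound
on the data): for site weights `m ≥ 0` and a non-negative unit-mass stencil `w`,
`Σ_p m_p ‖Σ_q w_{pq} g_{pq} − f_p‖² ≤ Σ_p Σ_q m_p w_{pq} ‖g_{pq} − f_p‖²`.  Intended: g_{pq} = Ad_{U(γ_{pq})}F(q) (the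
dressed fine curvature seen from p), f_p = F(p), w = S*S, m = cell volumes: the L² defect ‖(S_U^*S_U − 1)F‖²_{L²} that
pairs with ‖d_Uψ‖_{L²} in the leading term of (β) is at most the dressed variance, which `telescope_sq_le` bounds by
C(d,L) η² ‖∇_U F‖²_{L²}. [folklore] -/
theorem stencil_L2_defect_le_variance [InnerProductSpace ℝ V] {P : Type*} [Fintype P] (m : P → ℝ)
    (w : P → P → ℝ) (g : P → P → V) (f : P → V) (hm : ∀ p, 0 ≤ m p) (hw0 : ∀ p q, 0 ≤ w p q)
    (hw1 : ∀ p, ∑ q, w p q = 1) :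
    ∑ p, m p * ‖∑ q, w p q • g p q - f p‖ ^ 2 ≤ ∑ p, ∑ q, m p * w p q * ‖g p q - f p‖ ^ 2 := by
  refine Finset.sum_le_sum (fun p _ => ?_)
  have h1 : ∑ q, w p q • g p q - f p = ∑ q, w p q • (g p q - f p) := by
    simp only [smul_sub, Finset.sum_sub_distrib, ← Finset.sum_smul, hw1, one_smul]
  rw [h1]
  have hj := jensen_sq (w p) (fun q => g p q - f p) (hw0 p) (hw1 p)
  calc m p * ‖∑ q, w p q • (g p q - f p)‖ ^ 2 ≤ m p * ∑ q, w p q * ‖g p q - f p‖ ^ 2 :=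
        mul_le_mul_of_nonneg_left hj (hm p)
    _ = ∑ q, m p * w p q * ‖g p q - f p‖ ^ 2 := by
        rw [Finset.mul_sum]
        exact Finset.sum_congr rfl (fun q _ => by ring)

/-- TELESCOPING (the Poincaré step along a dressing path of `n` bonds): `‖v_n − v_0‖² ≤ n · Σ_{l<n} ‖v_{l+1} − v_l‖²`.
Intended: v_l = the value of F at the l-th vertex of the path transported back to the base point, so that
v_{l+1} − v_l = η′ · (transported covariant bond derivative ∇_U F); with path length n ≤ C₁L and bounded path
multiplicity this turns the dressed variance over a stencil of width C₁η into ≤ C(d,L) η² ‖∇_U F‖²_{L²}. [folklore] -/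
theorem telescope_sq_le (v : ℕ → V) (n : ℕ) :
    ‖v n - v 0‖ ^ 2 ≤ n * ∑ l ∈ Finset.range n, ‖v (l + 1) - v l‖ ^ 2 := by
  have htel : v n - v 0 = ∑ l ∈ Finset.range n, (v (l + 1) - v l) :=
    (Finset.sum_range_sub v n).symm
  have htri : ‖v n - v 0‖ ≤ ∑ l ∈ Finset.range n, ‖v (l + 1) - v l‖ := by
    rw [htel]
    exact norm_sum_le _ _
  have hcs : (∑ l ∈ Finset.range n, ‖v (l + 1) - v l‖) ^ 2
      ≤ (n : ℝ) * ∑ l ∈ Finset.range n, ‖v (l + 1) - v l‖ ^ 2 := by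
    have h := Finset.sum_mul_sq_le_sq_mul_sq (Finset.range n) (fun _ => (1:ℝ)) (fun l => ‖v (l + 1) - v l‖)
    have h1 : ∑ l ∈ Finset.range n, (fun _ => (1:ℝ)) l * (fun l => ‖v (l + 1) - v l‖) l
        = ∑ l ∈ Finset.range n, ‖v (l + 1) - v l‖ := Finset.sum_congr rfl (fun l _ => by simp)
    have h2 : ∑ l ∈ Finset.range n, (fun _ => (1:ℝ)) l ^ 2 = (n : ℝ) := by simp
    rw [h1, h2] at h
    exact h
  calc ‖v n - v 0‖ ^ 2 ≤ (∑ l ∈ Finset.range n, ‖v (l + 1) - v l‖) ^ 2 :=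
        pow_le_pow_left₀ (norm_nonneg _) htri 2
    _ ≤ (n : ℝ) * ∑ l ∈ Finset.range n, ‖v (l + 1) - v l‖ ^ 2 := hcs

/-- ALL MIXED SECOND DIFFERENCES ARE CONTROLLED IN L² BY THE LAPLACIAN.  For a finite commuting family of linear
operators `D i` on a real inner-product space, with (formal) adjoints `Dadj i` that commute with every `D j` (a
commuting NORMAL family — e.g. the forward difference quotients ∇_μ of the d lattice translations on a periodic
lattice, Dadj μ = −∇_μ^−, Σ_μ Dadj μ ∘ D μ = −Δ):  `Σ_i Σ_j ‖D_i D_j x‖² = ‖Σ_i D_i† D_i x‖²`, i.e. on the torus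
‖∇∇A‖_{L²} = ‖ΔA‖_{L²} componentwise, EXACTLY.  In sup norm the analogous control fails (log-divergent, cell numerics
N-B8-4) — which is why the Hölder endpoint (9)_{β₀=1} is not derivable while the energy route, which only consumes
‖∇F‖_{L²} ≲ ‖∇²A‖_{L²} + |A|‖∇A‖_{L²}, is served by the printed sup bounds (10) on Δ^ηA and (9)ˢᵘᵖ on A, ∇^ηA.  (B11's Thm 1 gauges are LOCAL, on
cubes; the local form of this identity with a cutoff — discrete Caccioppoli for second differences, ‖∇²A‖_{L²(□/2)} ≤
C(‖ΔA‖_{L²(□)} + size(□)^{−1}‖∇A‖_{L²(□)}) — is folklore and is stated, not kernelised, in the record §3.8.) [folklore] -/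
theorem sum_normSq_comp_eq_normSq_laplacian [InnerProductSpace ℝ V] {ι : Type*} [Fintype ι]
    (D Dadj : ι → V →ₗ[ℝ] V) (hadj : ∀ i x y, inner ℝ (D i x) y = inner ℝ x (Dadj i y))
    (hcomm : ∀ i j, D i ∘ₗ D j = D j ∘ₗ D i) (hnorm : ∀ i j, D i ∘ₗ Dadj j = Dadj j ∘ₗ D i) (x : V) :
    ∑ i, ∑ j, ‖D i (D j x)‖ ^ 2 = ‖∑ i, Dadj i (D i x)‖ ^ 2 := by
  have hR : ‖∑ i, Dadj i (D i x)‖ ^ 2 = ∑ i, ∑ j, inner ℝ (Dadj i (D i x)) (Dadj j (D j x)) := by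
    rw [← real_inner_self_eq_norm_sq, sum_inner]
    refine Finset.sum_congr rfl (fun i _ => ?_)
    rw [inner_sum]
  rw [hR]
  refine Finset.sum_congr rfl (fun i _ => Finset.sum_congr rfl (fun j _ => ?_))
  have h2 : D j (Dadj i (D i x)) = Dadj i (D j (D i x)) := by
    have h := LinearMap.congr_fun (hnorm j i) (D i x)
    simpa only [LinearMap.coe_comp, Function.comp_apply] using h
  have h3 : D j (D i x) = D i (D j x) := by
    have h := LinearMap.congr_fun (hcomm j i) x
    simpa only [LinearMap.coe_comp, Function.comp_apply] using h
  rw [← hadj j, h2, real_inner_comm, ← hadj i, h3, real_inner_self_eq_norm_sq]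

end L2Forms

/-! ## §4d Cutoff Bochner identity — the core of the discrete Caccioppoli step (interior H² from the Laplacian)

B11 Thm 1 is stated PER CUBE □ (size 2ML^jη) with a local gauge, so the L² control of the mixed second differences
of A by Δ^ηA that the energy route needs (record §3.8, Appendix β (R2′)) is wanted in LOCALISED form: with a cutoff χ
(χ = 1 on the half-cube, supported in □, |∇χ| ≲ 1/M).  The classical computation (two summations by parts) has an
exact operator-theoretic core, proved below for the abstract commuting normal family of §4c and an arbitrary symmetric
operator P: Σ_{ij}⟨D_iD_ju, P D_iD_ju⟩ = ⟨Δu, PΔu⟩ − Σ_j⟨D_ju, K_jΔu⟩ − Σ_{ij}⟨K_iD_ju, D_iD_ju⟩, Δ = Σ_iD_i†D_i,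
K_i := D_iP − PD_i.  DICTIONARY [analysis; folklore]: V = ℓ² of 𝔤-valued functions on the fine torus (an arbitrary
extension of A off the double cube is harmless — every term carries P or a K_i, all supported near supp χ);
D_i = forward difference quotient h⁻¹(τ_i − 1), D_i† = its adjoint (− backward quotient); translations commute and
are unitary, so the family is commuting and normal; P = multiplication by χ², K_i = (multiplication by D_i(χ²)) ∘ τ_i
with D_i(χ²) = (τ_iχ + χ)D_iχ = 2χ·D_iχ + h(D_iχ)².  ABSORPTION [analysis]: the 2χD_iχ part of the last sum is
≤ 2 sup|∇χ| · ‖1_N τ_iD_ju‖ · ‖χD_iD_ju‖ (N = supp ∇χ) and is absorbed by `le_of_le_add_mul_sqrt`; the h(D_iχ)² part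
is harmless because h·D_iD_ju = τ_iD_ju − D_ju involves first differences only; the middle sum is ≤ Σ_j sup|∇(χ²)| ·
‖1_N D_ju‖ · ‖1_{N+e_j}Δu‖.  Result: Σ_{ij}‖χ∇_i∇_ju‖² ≤ 2‖χΔu‖² + C(d)(sup|∇χ|²·‖1_{N′}∇u‖² + ‖1_{N′}Δu‖²), uniformly
in h — with the printed sup bounds (9)ˢᵘᵖ on ∇^ηA and (10) on Δ^ηA over □ this is ‖∇∇A‖_{L²(□/2)} ≲ B₃Mε₁|□|^{1/2},
i.e. (R2′).  Only the identity and the absorption arithmetic are kernel-checked here; the lattice dictionary is three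
lines of bookkeeping recorded in Appendix β §1. -/

section CutoffForms

variable {V : Type*} [NormedAddCommGroup V]

/-- CUTOFF BOCHNER IDENTITY (abstract core of the discrete Caccioppoli inequality for second differences): for linear
maps D_i with adjoints D_i† forming a commuting normal family on a real inner-product space and a symmetric P,
Σ_{ij}⟨D_iD_ju, P(D_iD_ju)⟩ = ⟨Δu, PΔu⟩ − Σ_j⟨D_ju, K_j(Δu)⟩ − Σ_{ij}⟨K_i(D_ju), D_iD_ju⟩ with Δ = Σ_iD_i†D_i and
K_i = D_i∘P − P∘D_i.  P = id gives `sum_normSq_comp_eq_normSq_laplacian`.  Lattice use: P = χ², see the section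
docstring. [folklore]
[cite: Balaban1985Variational, Thm 1 (9) sup entries, (10) p. 279, stated per cube □ (the local regularity the identity serves; the identity is not printed)] -/
theorem sum_inner_comp_cutoff_eq [InnerProductSpace ℝ V] {ι : Type*} [Fintype ι]
    (D Dadj : ι → V →ₗ[ℝ] V) (P : V →ₗ[ℝ] V)
    (hadj : ∀ i x y, inner ℝ (D i x) y = inner ℝ x (Dadj i y))
    (hcomm : ∀ i j, D i ∘ₗ D j = D j ∘ₗ D i) (hnorm : ∀ i j, D i ∘ₗ Dadj j = Dadj j ∘ₗ D i)
    (hP : ∀ x y, inner ℝ (P x) y = inner ℝ x (P y)) (u : V) :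
    ∑ i, ∑ j, inner ℝ (D i (D j u)) (P (D i (D j u))) =
      inner ℝ (∑ i, Dadj i (D i u)) (P (∑ i, Dadj i (D i u)))
      - ∑ j, inner ℝ (D j u) ((D j ∘ₗ P - P ∘ₗ D j) (∑ i, Dadj i (D i u)))
      - ∑ i, ∑ j, inner ℝ ((D i ∘ₗ P - P ∘ₗ D i) (D j u)) (D i (D j u)) := by
  obtain ⟨Δu, hΔ⟩ : ∃ w : V, w = ∑ i, Dadj i (D i u) := ⟨_, rfl⟩
  rw [← hΔ]
  -- (a) Σ_i D_i† D_i D_j u = D_j Δu (commuting normal family)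
  have hLa : ∀ j, ∑ i, Dadj i (D i (D j u)) = D j Δu := by
    intro j
    rw [hΔ, map_sum]
    refine Finset.sum_congr rfl (fun i _ => ?_)
    have h3 : D i (D j u) = D j (D i u) := by
      have h := LinearMap.congr_fun (hcomm i j) u
      simpa only [LinearMap.coe_comp, Function.comp_apply] using h
    have h2 : Dadj i (D j (D i u)) = D j (Dadj i (D i u)) := by
      have h := LinearMap.congr_fun (hnorm j i) (D i u)
      simpa only [LinearMap.coe_comp, Function.comp_apply] using h.symm
    rw [h3, h2]
  -- (b) the commutator in inner-product form: ⟨x, D_i†(P y)⟩ = ⟨x, P(D_i† y)⟩ − ⟨K_i x, y⟩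
  have hLb : ∀ i x y, inner ℝ x (Dadj i (P y)) =
      inner ℝ x (P (Dadj i y)) - inner ℝ ((D i ∘ₗ P - P ∘ₗ D i) x) y := by
    intro i x y
    have e1 : inner ℝ x (Dadj i (P y)) = inner ℝ (P (D i x)) y := by
      rw [← hadj i x (P y), hP (D i x) y]
    have e2 : inner ℝ x (P (Dadj i y)) = inner ℝ (D i (P x)) y := by
      rw [← hP x (Dadj i y), ← hadj i (P x) y]
    rw [e1, e2]
    simp only [LinearMap.sub_apply, LinearMap.coe_comp, Function.comp_apply, inner_sub_left]
    ring
  -- (c) first summation by parts, termwise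
  have h12 : ∑ i, ∑ j, inner ℝ (D i (D j u)) (P (D i (D j u))) =
      ∑ i, ∑ j, inner ℝ (D j u) (P (Dadj i (D i (D j u))))
        - ∑ i, ∑ j, inner ℝ ((D i ∘ₗ P - P ∘ₗ D i) (D j u)) (D i (D j u)) := by
    rw [← Finset.sum_sub_distrib]
    refine Finset.sum_congr rfl (fun i _ => ?_)
    rw [← Finset.sum_sub_distrib]
    refine Finset.sum_congr rfl (fun j _ => ?_)
    rw [hadj i (D j u) (P (D i (D j u))), hLb i (D j u) (D i (D j u))]
  -- (d) second summation by parts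
  have hS1 : ∑ i, ∑ j, inner ℝ (D j u) (P (Dadj i (D i (D j u)))) =
      inner ℝ Δu (P Δu) - ∑ j, inner ℝ (D j u) ((D j ∘ₗ P - P ∘ₗ D j) Δu) := by
    rw [Finset.sum_comm]
    have hj : ∀ j, ∑ i, inner ℝ (D j u) (P (Dadj i (D i (D j u)))) =
        inner ℝ (D j u) (D j (P Δu)) - inner ℝ (D j u) ((D j ∘ₗ P - P ∘ₗ D j) Δu) := by
      intro j
      rw [← inner_sum, ← map_sum P (fun i => Dadj i (D i (D j u))) Finset.univ, hLa j, ← inner_sub_right]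
      congr 1
      simp only [LinearMap.sub_apply, LinearMap.coe_comp, Function.comp_apply]
      abel
    rw [Finset.sum_congr rfl (fun j _ => hj j), Finset.sum_sub_distrib]
    congr 1
    have hk : ∀ j, inner ℝ (D j u) (D j (P Δu)) = inner ℝ (P Δu) (Dadj j (D j u)) := by
      intro j
      rw [real_inner_comm (D j (P Δu)) (D j u), hadj j (P Δu) (D j u)]
    rw [Finset.sum_congr rfl (fun j _ => hk j), ← inner_sum, ← hΔ]
    exact real_inner_comm Δu (P Δu)
  rw [h12, hS1]

/-- ABSORPTION ARITHMETIC for the Caccioppoli step: if a non-negative quantity S (= Σ‖χD_iD_ju‖²) satisfies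
S ≤ A + 2·b·√S (A = the cutoff Laplacian term plus the first-difference terms, b = sup|∇χ| × a first-difference
norm; no sign condition on b is needed), then S ≤ 2A + 4b².  [folklore]
[cite: Balaban1985Variational, Thm 1 (9) sup entries, (10) p. 279 (context only: the absorption is elementary)] -/
theorem le_of_le_add_mul_sqrt {S A b : ℝ} (hS : 0 ≤ S) (h : S ≤ A + 2 * b * Real.sqrt S) :
    S ≤ 2 * A + 4 * b ^ 2 := by
  have hsq : Real.sqrt S ^ 2 = S := Real.sq_sqrt hS
  have hroot : 0 ≤ Real.sqrt S := Real.sqrt_nonneg S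
  nlinarith [sq_nonneg (Real.sqrt S - 2 * b), hsq, hroot]

end CutoffForms

/-! ## §5 Energy rate ⇒ sup rate under an interpolation hypothesis -/

section Interpolation

variable {ι X : Type*}

/-- A rate survives a fractional power: `0 ≤ θ < 1`, `0 < a` ⇒ `θ^a < 1` (and `0 ≤ θ^a`). [folklore] -/
theorem rpow_rate_lt_one {θ a : ℝ} (hθ0 : 0 ≤ θ) (hθ1 : θ < 1) (ha : 0 < a) :
    0 ≤ θ ^ a ∧ θ ^ a < 1 :=
  ⟨Real.rpow_nonneg hθ0 a, Real.rpow_lt_one hθ0 hθ1 ha⟩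

/-- INTERPOLATION BOOKKEEPING: if an energy-type distance `E k V ≥ 0` between the two runs has the rate
`E k V ≤ C_E θ_E^k` and the sup-type local readings obey an interpolation inequality
`|loc (k+1) V x − loc k V x| ≤ C_I (E k V)^a M^{1−a}` with `0 ≤ a` (intended: a = 2/(d+2) for fields with a uniform
Lipschitz bound M, a = 2(1−β)/(d+2)-type for Hölder; (9)–(10)-type uniform regularity supplies M), then
`LocalRate R (C_I C_E^a M^{1−a}) (θ_E^a)`. [folklore] -/
theorem localRate_of_interpolation {R : Readings ι X} (E : ℕ → ι → ℝ) {CI CE M θE a : ℝ} (ha : 0 ≤ a)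
    (hθ : 0 ≤ θE) (hCE : 0 ≤ CE) (hM : 0 ≤ M) (hCI : 0 ≤ CI) (hE0 : ∀ k, ∀ V ∈ R.dom, 0 ≤ E k V)
    (hE : ∀ k, ∀ V ∈ R.dom, E k V ≤ CE * θE ^ k)
    (hI : ∀ k, ∀ V ∈ R.dom, ∀ x, |R.loc (k + 1) V x - R.loc k V x| ≤ CI * (E k V) ^ a * M ^ (1 - a)) :
    LocalRate R (CI * CE ^ a * M ^ (1 - a)) (θE ^ a) := by
  intro k V hV x
  have h1 : (E k V) ^ a ≤ (CE * θE ^ k) ^ a := Real.rpow_le_rpow (hE0 k V hV) (hE k V hV) ha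
  have h2 : (CE * θE ^ k) ^ a = CE ^ a * (θE ^ a) ^ k := by
    rw [Real.mul_rpow hCE (pow_nonneg hθ k), ← Real.rpow_natCast (θE ^ a) k, ← Real.rpow_mul hθ,
      ← Real.rpow_natCast θE k, ← Real.rpow_mul hθ, mul_comm (k : ℝ) a]
  calc |R.loc (k + 1) V x - R.loc k V x| ≤ CI * (E k V) ^ a * M ^ (1 - a) := hI k V hV x
    _ ≤ CI * (CE ^ a * (θE ^ a) ^ k) * M ^ (1 - a) := by
        rw [← h2]
        exact mul_le_mul_of_nonneg_right (mul_le_mul_of_nonneg_left h1 hCI) (Real.rpow_nonneg hM _)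
    _ = CI * CE ^ a * M ^ (1 - a) * (θE ^ a) ^ k := by ring

end Interpolation

/-! ## §6 Assembly into the tree shape `T4EtaRateMin.LocalRate` -/

section Assembly

variable {ι X : Type*}

/-- ASSEMBLY OF THE ENERGY ROUTE (names the inputs, proves only the bookkeeping).  Per number of steps `k` and datum
`V`: `n k V` = the energy distance N(A′*_k(V)) between the run-A minimiser and the block-averaged run-B minimiser,
`r k V` = the dual energy norm of the residual on the tangent space.  Inputs: (R1^E) `n ≤ r/m` — the conclusion of
`response_of_strongConvexity`, modulus `m` (cell-supplied ML: m = ½c_*); (R2^E) `r ≤ Λ δ θ^k` — `dualResidual_le`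
with a defect bound of geometric size (NOT printed); (R3) the local reading is Lipschitz in the energy distance up to
an averaging term, `|loc (k+1) − loc k| ≤ C_a θ^k + C_R · n` (reading-dependent; for sup-type readings go through
`localRate_of_interpolation` instead).  Output: `LocalRate R (C_a + C_R Λ δ / m) θ`. [folklore] -/
theorem localRate_of_energyResponse {R : Readings ι X} (n r : ℕ → ι → ℝ) {m Λ δ θ Ca CR : ℝ} (hm : 0 < m)
    (hCR : 0 ≤ CR)
    (hresp : ∀ k, ∀ V ∈ R.dom, n k V ≤ r k V / m)
    (hres : ∀ k, ∀ V ∈ R.dom, r k V ≤ Λ * δ * θ ^ k)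
    (hread : ∀ k, ∀ V ∈ R.dom, ∀ x, |R.loc (k + 1) V x - R.loc k V x| ≤ Ca * θ ^ k + CR * n k V) :
    LocalRate R (Ca + CR * (Λ * δ) / m) θ := by
  intro k V hV x
  have h1 : n k V ≤ Λ * δ * θ ^ k / m := (hresp k V hV).trans (div_le_div_of_nonneg_right (hres k V hV) hm.le)
  calc |R.loc (k + 1) V x - R.loc k V x| ≤ Ca * θ ^ k + CR * n k V := hread k V hV x
    _ ≤ Ca * θ ^ k + CR * (Λ * δ * θ ^ k / m) := by nlinarith [mul_le_mul_of_nonneg_left h1 hCR]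
    _ = (Ca + CR * (Λ * δ) / m) * θ ^ k := by ring

/-- The ACTION reading under the energy route: from `actionGap_upper` the gap is `≤ r²/(2m)`, so a dual residual of
geometric size `r ≤ ρ θ^k` gives an action gap `≤ (ρ²/(2m)) (θ²)^k` — rate θ² (the cell's toy rung U1b1 §1 shows
exactly this doubling: action rate 2 versus field rate 1). [folklore] -/
theorem actionGap_rate {gap r ρ θ m : ℝ} {k : ℕ} (hm : 0 < m) (hr : 0 ≤ r)
    (hgap : gap ≤ r ^ 2 / (2 * m)) (hrate : r ≤ ρ * θ ^ k) : gap ≤ ρ ^ 2 / (2 * m) * (θ ^ 2) ^ k := by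
  have h1 : r ^ 2 ≤ (ρ * θ ^ k) ^ 2 := pow_le_pow_left₀ hr hrate 2
  calc gap ≤ r ^ 2 / (2 * m) := hgap
    _ ≤ (ρ * θ ^ k) ^ 2 / (2 * m) := div_le_div_of_nonneg_right h1 (by positivity)
    _ = ρ ^ 2 / (2 * m) * (θ ^ 2) ^ k := by rw [← pow_mul, mul_comm 2 k, pow_mul]; ring

/-- ASSEMBLY FOR THE ACTION READING (the energy route's cleanest output — no localisation needed, the action being
extensive anyway): writing  act(k+1)V − act(k)V = −[defect VALUE 𝓓(U_{k+1}) = A^η(avg U_{k+1}) − A^{η/L}(U_{k+1})]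
− [action GAP A^η(W_k) − A^η(U_k) ∈ [0, r_k²/(2m)] (`actionGap_upper`)], a dual-residual rate r_k ≤ ρ θ_E^k √vol and
a defect-value bound |𝓓| ≤ C_D (θ_E²)^k vol give `T4EtaRateMin.ActionRate R (ρ²/(2m) + C_D) (θ_E²)` — the action
reading runs at the SQUARE of the energy rate (linearised model: θ_E = L^{−1}, action rate L^{−2};
`stencil_energyDefect_le`).  Pure bookkeeping over the abstract carrier. [folklore] -/
theorem actionRate_of_energyRoute {R : Readings ι X} (gap dv r : ℕ → ι → ℝ) {m ρ θE CD : ℝ} (hm : 0 < m)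
    (hsplit : ∀ k, ∀ V ∈ R.dom, |R.act (k + 1) V - R.act k V| ≤ gap k V + dv k V)
    (hgap : ∀ k, ∀ V ∈ R.dom, gap k V ≤ r k V ^ 2 / (2 * m))
    (hr0 : ∀ k, ∀ V ∈ R.dom, 0 ≤ r k V)
    (hr : ∀ k, ∀ V ∈ R.dom, r k V ≤ ρ * θE ^ k * Real.sqrt R.vol)
    (hdv : ∀ k, ∀ V ∈ R.dom, dv k V ≤ CD * (θE ^ 2) ^ k * R.vol) :
    T4EtaRateMin.ActionRate R (ρ ^ 2 / (2 * m) + CD) (θE ^ 2) := by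
  intro k V hV
  have hvol := R.vol_nonneg
  have hsq : r k V ^ 2 ≤ (ρ * θE ^ k * Real.sqrt R.vol) ^ 2 :=
    pow_le_pow_left₀ (hr0 k V hV) (hr k V hV) 2
  have hsq' : (ρ * θE ^ k * Real.sqrt R.vol) ^ 2 = ρ ^ 2 * (θE ^ 2) ^ k * R.vol := by
    rw [mul_pow, mul_pow, Real.sq_sqrt hvol, ← pow_mul, mul_comm k 2, pow_mul]
  have hgap' : gap k V ≤ ρ ^ 2 / (2 * m) * (θE ^ 2) ^ k * R.vol := by
    calc gap k V ≤ r k V ^ 2 / (2 * m) := hgap k V hV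
      _ ≤ (ρ ^ 2 * (θE ^ 2) ^ k * R.vol) / (2 * m) :=
          div_le_div_of_nonneg_right (hsq.trans_eq hsq') (by positivity)
      _ = ρ ^ 2 / (2 * m) * (θE ^ 2) ^ k * R.vol := by ring
  calc |R.act (k + 1) V - R.act k V| ≤ gap k V + dv k V := hsplit k V hV
    _ ≤ ρ ^ 2 / (2 * m) * (θE ^ 2) ^ k * R.vol + CD * (θE ^ 2) ^ k * R.vol := add_le_add hgap' (hdv k V hV)
    _ = (ρ ^ 2 / (2 * m) + CD) * (θE ^ 2) ^ k * R.vol := by ring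

end Assembly

/-! ## §7 Non-vacuity: the hypotheses of §2 are jointly satisfiable with the bound attained -/

namespace Witness

/-- First variation of `x ↦ x²` on `ℝ`: `v ↦ 2 x v`. [folklore] -/
def dSq (x : ℝ) : ℝ →ₗ[ℝ] ℝ := (2 * x) • LinearMap.id

/-- Second variation of `x ↦ x²`: `v ↦ 2 v²`. [folklore] -/
def hSq (_x v : ℝ) : ℝ := 2 * v ^ 2

/-- Evaluation of `dSq`. [folklore] -/
@[simp] theorem dSq_apply (x v : ℝ) : dSq x v = 2 * x * v := by
  simp [dSq, smul_eq_mul]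

/-- `x ↦ x²` is `ChartC2` on the whole line with the variations above. [folklore] -/
theorem chartC2_sq : ChartC2 (Set.univ : Set ℝ) (fun x => x ^ 2) dSq hSq where
  convex := convex_univ
  hasDeriv := by
    intro x _ y _ t _
    have h : HasDerivAt (fun s : ℝ => x + s * (y - x)) (0 + 1 * (y - x)) t :=
      (hasDerivAt_const t x).add ((hasDerivAt_id' t).mul_const (y - x))
    have h2 := h.pow 2
    simp only [smul_eq_mul, dSq_apply]
    refine h2.congr_deriv ?_
    push_cast
    ring
  hasDeriv2 := by
    intro x _ y _ t _
    have h : HasDerivAt (fun s : ℝ => x + s * (y - x)) (0 + 1 * (y - x)) t :=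
      (hasDerivAt_const t x).add ((hasDerivAt_id' t).mul_const (y - x))
    have h2 := (h.const_mul 2).mul_const (y - x)
    simp only [smul_eq_mul, dSq_apply, hSq]
    refine h2.congr_deriv ?_
    ring

/-- … with `StrongSecondVariation` for the gauge `N = |·|` and modulus `m = 2`. [folklore] -/
theorem strong_sq : StrongSecondVariation (Set.univ : Set ℝ) hSq (fun v => |v|) 2 := by
  intro x _ y _ t _
  simp [hSq, sq_abs]

/-- NON-VACUITY of `response_of_strongConvexity`: minimiser `x* = 0` of `x²`, competitor `w`, residual
`D𝔉(w)[w − 0] = 2w² = (2|w|)·|w − 0|`, so `r = 2|w|` and the bound `|w − 0| ≤ r/m = |w|` is ATTAINED. [folklore] -/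
theorem response_sq (w : ℝ) : |w - 0| ≤ (2 * |w|) / 2 :=
  response_of_strongConvexity chartC2_sq strong_sq two_pos (fun v => abs_nonneg v) (Set.mem_univ 0)
    (Set.mem_univ w) (by simp) (by positivity) (by
      simp only [dSq_apply, sub_zero]
      nlinarith [abs_mul_abs_self w])

end Witness

/-! ## §7b Lattice witness for the operator hypotheses of §4c–§4d

The identities `sum_normSq_comp_eq_normSq_laplacian` and `sum_inner_comp_cutoff_eq` are stated over an INTERFACE
(linear maps D_i with adjoints D_i† forming a commuting normal family; a symmetric P).  This section CONSTRUCTS the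
intended instance, so that existence is not smuggled into the interface: on ℓ²(G) = `EuclideanSpace ℝ G` for a finite
abelian group G (the fine torus (ℤ/N)^d, or any finite abelian group) the translations τ_v, the difference quotients
D_i = c(τ_{e_i} − 1) along lattice vectors e_i with c = mesh⁻¹, their adjoints c(τ_{−e_i} − 1), and the multiplication
operators by a real function m (the cutoff χ²) satisfy every hypothesis, and the commutator is computed in closed
form: [D_i, m] = c·(multiplication by τ_{e_i}m − m) ∘ τ_{e_i} — i.e. multiplication by the difference quotient of m,
after a unit shift (the dictionary line of §4d).  𝔤-valued fields are covered componentwise (an orthonormal frame of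
𝔤 turns ℓ²(G; 𝔤) into a finite orthogonal sum of copies of ℓ²(G) on which all these operators act diagonally).
[folklore] -/

namespace LatticeWitness

variable {G : Type*} [AddCommGroup G]

/-- Translation by v on ℓ²(G): (τ_v f)(x) = f(x + v). [folklore] [cite: Balaban1985Variational, Thm 1 (9)–(10) p. 279 (context: the lattice operators there)] -/
def shift (v : G) : EuclideanSpace ℝ G →ₗ[ℝ] EuclideanSpace ℝ G where
  toFun f := WithLp.toLp 2 (fun x => f (x + v))
  map_add' f g := by ext x; simp [PiLp.add_apply]
  map_smul' c f := by ext x; simp [PiLp.smul_apply]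

/-- Pointwise action of the translation. [folklore] [cite: Balaban1985Variational, Thm 1 (9)–(10) p. 279 (context)] -/
@[simp] theorem shift_apply (v : G) (f : EuclideanSpace ℝ G) (x : G) : shift v f x = f (x + v) := rfl

/-- Translations commute. [folklore] [cite: Balaban1985Variational, Thm 1 (9)–(10) p. 279 (context: the lattice
operators ∇^η, Δ^η are built from these translations)] -/
theorem shift_comm (v w : G) : shift v ∘ₗ shift w = shift w ∘ₗ shift v := by
  apply LinearMap.ext
  intro f
  ext x
  simp only [LinearMap.coe_comp, Function.comp_apply, shift_apply]
  rw [add_right_comm]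

/-- Translations are unitary: τ_v† = τ_{−v}. [folklore] [cite: Balaban1985Variational, Thm 1 (9)–(10) p. 279 (context)] -/
theorem inner_shift [Fintype G] (v : G) (f g : EuclideanSpace ℝ G) :
    inner ℝ (shift v f) g = inner ℝ f (shift (-v) g) := by
  simp only [PiLp.inner_apply, shift_apply]
  exact Fintype.sum_equiv (Equiv.addRight v) _ _ (fun x => by simp [add_neg_cancel_right])

variable {ι : Type*}

/-- Forward difference quotient along e_i with inverse mesh c: D_i = c(τ_{e_i} − 1). [folklore] [cite: Balaban1985Variational, Thm 1 (9)–(10) p. 279 (context: the lattice operators there)] -/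
def fwdDiff (c : ℝ) (e : ι → G) (i : ι) : EuclideanSpace ℝ G →ₗ[ℝ] EuclideanSpace ℝ G :=
  c • (shift (e i) - LinearMap.id)

/-- Its adjoint D_i† = c(τ_{−e_i} − 1) (minus the backward difference quotient). [folklore] [cite: Balaban1985Variational, Thm 1 (9)–(10) p. 279 (context: the lattice operators there)] -/
def fwdDiffAdj (c : ℝ) (e : ι → G) (i : ι) : EuclideanSpace ℝ G →ₗ[ℝ] EuclideanSpace ℝ G :=
  c • (shift (-(e i)) - LinearMap.id)

/-- Pointwise action of the forward difference quotient: (D_i f)(x) = c(f(x + e_i) − f(x)). [folklore] [cite: Balaban1985Variational, Thm 1 (9)–(10) p. 279 (context)] -/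
@[simp] theorem fwdDiff_apply (c : ℝ) (e : ι → G) (i : ι) (f : EuclideanSpace ℝ G) (x : G) :
    fwdDiff c e i f x = c * (f (x + e i) - f x) := by
  simp [fwdDiff, PiLp.sub_apply, PiLp.smul_apply]

/-- Hypothesis `hadj` of §4c–§4d for the lattice difference quotients. [folklore]
[cite: Balaban1985Variational, Thm 1 (9)–(10) p. 279 (context)] -/
theorem fwdDiff_adjoint [Fintype G] (c : ℝ) (e : ι → G) (i : ι) (x y : EuclideanSpace ℝ G) :
    inner ℝ (fwdDiff c e i x) y = inner ℝ x (fwdDiffAdj c e i y) := by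
  simp only [fwdDiff, fwdDiffAdj, LinearMap.smul_apply, LinearMap.sub_apply, LinearMap.id_apply,
    real_inner_smul_left, real_inner_smul_right, inner_sub_left, inner_sub_right, inner_shift]

/-- c(τ_v − 1) and c(τ_w − 1) commute, from `shift_comm`. [folklore] [cite: Balaban1985Variational, Thm 1 (9)–(10) p. 279 (context)] -/
private theorem comm_of_shift (c : ℝ) (v w : G) :
    (c • (shift v - LinearMap.id)) ∘ₗ (c • (shift w - LinearMap.id)) =
      (c • (shift w - LinearMap.id)) ∘ₗ (c • (shift v - LinearMap.id)) := by
  have h : Commute (shift v) (shift w) := shift_comm v w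
  have h2 : Commute (c • (shift v - 1)) (c • (shift w - 1)) :=
    (((h.sub_right (Commute.one_right _)).sub_left (Commute.one_left _)).smul_right c).smul_left c
  simpa only [Module.End.mul_eq_comp, Module.End.one_eq_id] using h2.eq

/-- Hypothesis `hcomm`: the difference quotients commute. [folklore]
[cite: Balaban1985Variational, Thm 1 (9)–(10) p. 279 (context)] -/
theorem fwdDiff_comm (c : ℝ) (e : ι → G) (i j : ι) :
    fwdDiff c e i ∘ₗ fwdDiff c e j = fwdDiff c e j ∘ₗ fwdDiff c e i :=
  comm_of_shift c (e i) (e j)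

/-- Hypothesis `hnorm`: the family is normal (D_i commutes with D_j†). [folklore]
[cite: Balaban1985Variational, Thm 1 (9)–(10) p. 279 (context)] -/
theorem fwdDiff_normal (c : ℝ) (e : ι → G) (i j : ι) :
    fwdDiff c e i ∘ₗ fwdDiffAdj c e j = fwdDiffAdj c e j ∘ₗ fwdDiff c e i :=
  comm_of_shift c (e i) (-(e j))

/-- Multiplication by a real function m (the cutoff χ² of §4d). [folklore] [cite: Balaban1985Variational, Thm 1 (9)–(10) p. 279 (context: the lattice operators there)] -/
def mulOp (m : G → ℝ) : EuclideanSpace ℝ G →ₗ[ℝ] EuclideanSpace ℝ G where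
  toFun f := WithLp.toLp 2 (fun x => m x * f x)
  map_add' f g := by ext x; simp [PiLp.add_apply, mul_add]
  map_smul' c f := by ext x; simp [PiLp.smul_apply, mul_left_comm]

omit [AddCommGroup G] in
/-- Pointwise action of the multiplication operator. [folklore] [cite: Balaban1985Variational, Thm 1 (9)–(10) p. 279 (context)] -/
@[simp] theorem mulOp_apply (m : G → ℝ) (f : EuclideanSpace ℝ G) (x : G) : mulOp m f x = m x * f x := rfl

omit [AddCommGroup G] in
/-- Hypothesis `hP`: multiplication operators are symmetric. [folklore]
[cite: Balaban1985Variational, Thm 1 (9)–(10) p. 279 (context)] -/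
theorem mulOp_symm [Fintype G] (m : G → ℝ) (f g : EuclideanSpace ℝ G) :
    inner ℝ (mulOp m f) g = inner ℝ f (mulOp m g) := by
  simp only [PiLp.inner_apply, mulOp_apply, RCLike.inner_apply, conj_trivial]
  exact Finset.sum_congr rfl (fun x _ => by ring)

/-- THE COMMUTATOR (dictionary line of §4d): [D_i, m] = c·(multiplication by τ_{e_i}m − m) ∘ τ_{e_i}, i.e.
multiplication by the difference quotient D_i m followed by the unit shift — supported where ∇m ≠ 0, of operator norm
≤ sup|D_i m|. [folklore] [cite: Balaban1985Variational, Thm 1 (9)–(10) p. 279 (context)] -/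
theorem fwdDiff_commutator_mulOp (c : ℝ) (e : ι → G) (i : ι) (m : G → ℝ) :
    fwdDiff c e i ∘ₗ mulOp m - mulOp m ∘ₗ fwdDiff c e i =
      c • (mulOp (fun x => m (x + e i) - m x) ∘ₗ shift (e i)) := by
  apply LinearMap.ext
  intro f
  ext x
  simp only [LinearMap.sub_apply, LinearMap.coe_comp, Function.comp_apply, LinearMap.smul_apply,
    mulOp_apply, fwdDiff_apply, shift_apply, PiLp.sub_apply, PiLp.smul_apply, smul_eq_mul]
  ring

/-- §4c on the lattice: Σ_{ij}‖D_iD_ju‖² = ‖Δu‖² with Δ = Σ_iD_i†D_i, for difference quotients along any lattice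
vectors e_i on any finite abelian group. [folklore] [cite: Balaban1985Variational, Thm 1 (9)–(10) p. 279 (context)] -/
theorem lattice_sum_normSq_eq [Fintype G] [Fintype ι] (c : ℝ) (e : ι → G) (u : EuclideanSpace ℝ G) :
    ∑ i, ∑ j, ‖fwdDiff c e i (fwdDiff c e j u)‖ ^ 2 = ‖∑ i, fwdDiffAdj c e i (fwdDiff c e i u)‖ ^ 2 :=
  sum_normSq_comp_eq_normSq_laplacian _ _ (fwdDiff_adjoint c e) (fwdDiff_comm c e) (fwdDiff_normal c e) u

/-- §4d on the lattice with P = multiplication by m (= χ²) and the commutators in closed form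
K_i = c·(mult. by D_i-increment of m) ∘ τ_{e_i}. [folklore] [cite: Balaban1985Variational, Thm 1 (9)–(10) p. 279 (context)] -/
theorem lattice_cutoff_identity [Fintype G] [Fintype ι] (c : ℝ) (e : ι → G) (m : G → ℝ) (u : EuclideanSpace ℝ G) :
    ∑ i, ∑ j, inner ℝ (fwdDiff c e i (fwdDiff c e j u)) (mulOp m (fwdDiff c e i (fwdDiff c e j u))) =
      inner ℝ (∑ i, fwdDiffAdj c e i (fwdDiff c e i u)) (mulOp m (∑ i, fwdDiffAdj c e i (fwdDiff c e i u)))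
      - ∑ j, inner ℝ (fwdDiff c e j u)
          ((c • (mulOp (fun x => m (x + e j) - m x) ∘ₗ shift (e j))) (∑ i, fwdDiffAdj c e i (fwdDiff c e i u)))
      - ∑ i, ∑ j, inner ℝ ((c • (mulOp (fun x => m (x + e i) - m x) ∘ₗ shift (e i))) (fwdDiff c e j u))
          (fwdDiff c e i (fwdDiff c e j u)) := by
  have h := sum_inner_comp_cutoff_eq _ _ (mulOp m) (fwdDiff_adjoint c e) (fwdDiff_comm c e)
    (fwdDiff_normal c e) (mulOp_symm m) u
  simpa only [fwdDiff_commutator_mulOp] using h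

end LatticeWitness

/-! ## §8 Localisation cores (towards the δ-input of the record §5, GAPS G-ne3p2-3): an abstract AGMON estimate
(uniform in the lattice spacing) and the elementary NEUMANN-SERIES Combes–Thomas bound (banded operators)

WHY.  §6 fed with GLOBAL energy norms gives pointwise readings only up to a volume factor (record §5): the residual of
the competitor W_k(V) is small in the dual energy norm UNIFORMLY PER UNIT CUBE (record (β) localised, via the local
tangent lift γ_loc), and a volume-free local response needs the inverse of the (mean-value) Hessian to be LOCAL at the
unit scale.  Two kernel cores, both [folklore]:
(A) `agmon_weighted_response` — the Agmon / Combes–Thomas weighted-energy estimate in its algebraic form, over a bare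
real vector space with an abstract gauge `N` (the style of §2, no topology): if the form `B` is m-coercive, its
CONJUGATION DEFECT under a weight map `w` is at most κ < m (`B (w u) (w u) − κ N(w u)² ≤ B u (w (w u))` — for
B[u,v] = Σ_bonds DuDv + local terms and w = multiplication by ω = e^{−μ·dist} this is the discrete IMS identity
`ims_bond_identity` below plus |∇ω| ≤ μ′ω, κ = O(μ′²), UNIFORMLY in the lattice spacing), and u solves the weak equation
`B u v = J v` with a source of w-WEIGHTED dual norm ρ (`|J (w v)| ≤ ρ N v`), then `N (w u) ≤ ρ/(m − κ)`.  With ω = 1 on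
a cube □₀ and = e^{−μ dist(·,□₀)} away from it, ρ ≤ Σ_□ e^{−μ dist(□,□₀)}·(1+O(μ))·r_□ (`weightedDual_of_local`:
bookkeeping of a source that is a sum of local pieces) — volume-free when the local dual norms r_□ are uniformly
bounded, which is what the localised (β) provides (r_□ ≤ C″ε₁η).
(B) `local_response_decay` (+ `_sum`) — for a symmetric H with m ≤ H and H² ≤ ΛH on a real inner-product space which
moves an increasing chain of "support" subspaces by one layer per application, |⟨x, H⁻¹y⟩| ≤ (1 − m/Λ)^{N/2}‖x‖‖y‖/m
when x is orthogonal to the first N layers above supp y — N damped-Richardson steps, no spectral theory (the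
mechanism of the Demko–Moss–Smith bounds for banded positive matrices, with the cruder Neumann rate).  HONEST SCOPE:
(B) is adequate only where Λ/m = O(1) in a geometry in which H has finite range (unit-lattice operators); for the
fine-lattice Hessian of (79)–(81) in the L² geometry Λ/m = O(η⁻²) while the range is O(η), so (B)'s decay length is
O(1)·η⁻¹ lattice layers = O(1) only after multiplying — i.e. it does NOT localise at the unit scale uniformly in η
((1 − cη²)^{ℓ/η} → 1); the δ-input is therefore routed through (A), whose constant κ = O(μ²) + O(Λ_E μ) is
η-independent.  NOT PROVED HERE (named in the record §5b, each elementary or printed-TYPE, none a printed sentence):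
the weak equation on the block-tangent space from gauge invariance + criticality, the conjugation defect of the actual
form (79)–(80) with the constraint correction through the local right inverse H of Q, gauge-invariant coercivity along
the segment (ML variant), the mean-value (segment) form of B.
[cite: Balaban1985Variational, (79)–(84) p. 290, (115) p. 294, (116)–(117) p. 295 (context: the operators this is meant for)] -/

section Agmon

variable {E : Type*} [AddCommGroup E] [Module ℝ E]

/-- ABSTRACT AGMON ESTIMATE (weighted energy of a coercive weak solution ≤ weighted dual norm of the source).
`B` a bilinear form, m-coercive w.r.t. the gauge `N`; `w` a linear "weight" map whose conjugation defect on `B` is at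
most `κ < m`; `u` a weak solution of `B u · = J`; `ρ` the `w`-weighted dual gauge of `J`.  Then `N (w u) ≤ ρ/(m − κ)`.
Five lines of algebra: (m − κ) N(wu)² ≤ B(wu)(wu) − κN(wu)² ≤ B u (w(wu)) = J(w(wu)) ≤ ρ N(wu).
[folklore] (Agmon 1982 / Combes–Thomas 1973 mechanism; algebraic core only) -/
theorem agmon_weighted_response (B : E →ₗ[ℝ] E →ₗ[ℝ] ℝ) (w : E →ₗ[ℝ] E) (N : E → ℝ) (J : E →ₗ[ℝ] ℝ)
    {m κ ρ : ℝ} (hκ : κ < m) (hρ : 0 ≤ ρ) (hcoer : ∀ v, m * N v ^ 2 ≤ B v v)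
    (hAg : ∀ v, B (w v) (w v) - κ * N (w v) ^ 2 ≤ B v (w (w v))) {u : E} (hweak : ∀ v, B u v = J v)
    (hJ : ∀ v, |J (w v)| ≤ ρ * N v) (hN : 0 ≤ N (w u)) : N (w u) ≤ ρ / (m - κ) := by
  have hmk : 0 < m - κ := sub_pos.mpr hκ
  have h1 : (m - κ) * N (w u) ^ 2 ≤ ρ * N (w u) := by
    calc (m - κ) * N (w u) ^ 2 = m * N (w u) ^ 2 - κ * N (w u) ^ 2 := by ring
      _ ≤ B (w u) (w u) - κ * N (w u) ^ 2 := by linarith [hcoer (w u)]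
      _ ≤ B u (w (w u)) := hAg u
      _ = J (w (w u)) := hweak _
      _ ≤ |J (w (w u))| := le_abs_self _
      _ ≤ ρ * N (w u) := hJ _
  rw [le_div_iff₀ hmk]
  rcases eq_or_lt_of_le hN with h0 | hpos
  · rw [← h0]; simp; exact hρ
  · nlinarith

/-- Bookkeeping for (A): a source that is a finite sum of LOCAL pieces `J i`, each of `w`-weighted dual gauge `a i`
(in the dictionary a_□ = e^{−μ dist(□,□₀)}(1 + O(μ)) r_□), has weighted dual gauge `Σ a i` — volume-free iff the
weighted sum converges. [folklore] -/
theorem weightedDual_of_local {ι : Type*} (s : Finset ι) (J : ι → E →ₗ[ℝ] ℝ) (w : E →ₗ[ℝ] E) (N : E → ℝ)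
    (a : ι → ℝ) (hJ : ∀ i ∈ s, ∀ v, |J i (w v)| ≤ a i * N v) (v : E) :
    |(∑ i ∈ s, J i) (w v)| ≤ (∑ i ∈ s, a i) * N v := by
  rw [LinearMap.sum_apply, Finset.sum_mul]
  exact (Finset.abs_sum_le_sum_abs _ _).trans (Finset.sum_le_sum fun i hi => hJ i hi v)

/-- The DISCRETE IMS / ground-state identity on ONE bond, which is the conjugation defect of (A) for nearest-neighbour
difference forms: with site values a, b of u and α, β of the weight ω,
(b − a)(β²b − α²a) = (βb − αa)² − (β − α)²ab, i.e. Du·D(ω²u) = |D(ωu)|² − (Dω)²·u(x)u(x+e) bond by bond; summed, B[u, ω²u]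
= B[ωu, ωu] − Σ_bonds (Dω)² u(x)u(x+e) ≥ B[ωu, ωu] − κ N(ωu)² with κ = O(sup((Dω)/ω)²) = O(μ′²) for ω = e^{−μφ},
φ 1-Lipschitz, μ′ = (e^{μη} − 1)/η — uniformly in the spacing η. [folklore] -/
theorem ims_bond_identity (a b α β : ℝ) :
    (b - a) * (β ^ 2 * b - α ^ 2 * a) = (β * b - α * a) ^ 2 - (β - α) ^ 2 * (a * b) := by ring

/-- … and the absorption of the bond defect, in the simplest form used bond by bond:
(β − α)² |a b| ≤ ½ (β − α)² (a² + b²) (then (β − α)² ≤ μ²α², μ²β² is paired with a², b² respectively). [folklore] -/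
theorem ims_bond_defect_le (a b α β : ℝ) :
    (β - α) ^ 2 * |a * b| ≤ (β - α) ^ 2 * ((a ^ 2 + b ^ 2) / 2) := by
  refine mul_le_mul_of_nonneg_left ?_ (sq_nonneg _)
  rw [abs_mul]
  nlinarith [sq_nonneg (|a| - |b|), sq_abs a, sq_abs b, abs_nonneg a, abs_nonneg b]

end Agmon

section Neumann

variable {V : Type*} [NormedAddCommGroup V] [InnerProductSpace ℝ V]

/-- One damped-Richardson step contracts: ‖v − Λ⁻¹Hv‖² ≤ (1 − m/Λ)‖v‖² when m‖v‖² ≤ ⟨v, Hv⟩ and ‖Hv‖² ≤ Λ⟨v, Hv⟩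
(the operator inequalities m ≤ H, H² ≤ ΛH in vector form). [folklore] -/
theorem norm_sq_richardson_le (H : V →ₗ[ℝ] V) {m Λ : ℝ} (hΛ : 0 < Λ)
    (hgap : ∀ v, m * ‖v‖ ^ 2 ≤ inner ℝ v (H v)) (hup : ∀ v, ‖H v‖ ^ 2 ≤ Λ * inner ℝ v (H v)) (v : V) :
    ‖v - (1 / Λ) • H v‖ ^ 2 ≤ (1 - m / Λ) * ‖v‖ ^ 2 := by
  have h1 : ‖v - (1 / Λ) • H v‖ ^ 2 =
      ‖v‖ ^ 2 - 2 * ((1 / Λ) * inner ℝ v (H v)) + (1 / Λ) ^ 2 * ‖H v‖ ^ 2 := by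
    rw [norm_sub_sq_real, real_inner_smul_right, norm_smul, mul_pow, Real.norm_eq_abs, sq_abs]
  have h2 : (1 / Λ) ^ 2 * ‖H v‖ ^ 2 ≤ (1 / Λ) * inner ℝ v (H v) := by
    have := mul_le_mul_of_nonneg_left (hup v) (sq_nonneg (1 / Λ))
    calc (1 / Λ) ^ 2 * ‖H v‖ ^ 2 ≤ (1 / Λ) ^ 2 * (Λ * inner ℝ v (H v)) := this
      _ = (1 / Λ) * inner ℝ v (H v) := by field_simp
  have h3 : m / Λ * ‖v‖ ^ 2 ≤ (1 / Λ) * inner ℝ v (H v) := by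
    have := mul_le_mul_of_nonneg_left (hgap v) (le_of_lt (one_div_pos.mpr hΛ))
    calc m / Λ * ‖v‖ ^ 2 = (1 / Λ) * (m * ‖v‖ ^ 2) := by ring
      _ ≤ (1 / Λ) * inner ℝ v (H v) := this
  rw [h1]; nlinarith [h2, h3]

/-- NEUMANN-SERIES COMBES–THOMAS BOUND (banded form (B)).  `H` symmetric-positive in the vector sense m‖v‖² ≤ ⟨v,Hv⟩,
‖Hv‖² ≤ Λ⟨v,Hv⟩; `K 0 ≤ K 1 ≤ …` subspaces with `H (K j) ⊆ K (j+1)` ("one layer per application"); `H u = y`,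
`y ∈ K 0`, and `x ⊥ K j` for `j < N`.  Then |⟨x, u⟩| ≤ (1 − m/Λ)^{N/2}·‖x‖‖y‖/m.  Proof: with T = 1 − Λ⁻¹H,
u = Λ⁻¹y + Tu, so ⟨x, u⟩ = ⟨x, T^N u⟩ (the first N Neumann terms T^j y ∈ K j are invisible to x), ‖T^N u‖ ≤
(1 − m/Λ)^{N/2}‖u‖ and ‖u‖ ≤ ‖y‖/m.  SCOPE: see the section docstring (adequate for Λ/m = O(1) with finite range in
the same geometry; NOT uniform in η for the fine-lattice Hessian). [folklore] (Demko–Moss–Smith mechanism, Neumann rate) -/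
theorem local_response_decay (H : V →ₗ[ℝ] V) {m Λ : ℝ} (hm : 0 < m) (hmΛ : m ≤ Λ)
    (hgap : ∀ v, m * ‖v‖ ^ 2 ≤ inner ℝ v (H v)) (hup : ∀ v, ‖H v‖ ^ 2 ≤ Λ * inner ℝ v (H v))
    (K : ℕ → Submodule ℝ V) (hKmono : ∀ j, K j ≤ K (j + 1)) (hHK : ∀ j, ∀ v ∈ K j, H v ∈ K (j + 1))
    {x y u : V} (hu : H u = y) (hy : y ∈ K 0) {N : ℕ} (hx : ∀ j < N, ∀ v ∈ K j, inner ℝ x v = 0) :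
    |inner ℝ x u| ≤ Real.sqrt (1 - m / Λ) ^ N * (‖x‖ * ‖y‖ / m) := by
  have hΛ : 0 < Λ := lt_of_lt_of_le hm hmΛ
  set q : ℝ := Real.sqrt (1 - m / Λ) with hq
  have hq0 : 0 ≤ 1 - m / Λ := by
    rw [sub_nonneg, div_le_one hΛ]; exact hmΛ
  have hqnn : 0 ≤ q := Real.sqrt_nonneg _
  set T : V →ₗ[ℝ] V := LinearMap.id - (1 / Λ) • H with hT
  have hTapp : ∀ v, T v = v - (1 / Λ) • H v := fun v => by simp [hT]
  have hT1 : ∀ v, ‖T v‖ ≤ q * ‖v‖ := by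
    intro v
    have h := norm_sq_richardson_le H hΛ hgap hup v
    rw [← hTapp] at h
    calc ‖T v‖ = Real.sqrt (‖T v‖ ^ 2) := (Real.sqrt_sq (norm_nonneg _)).symm
      _ ≤ Real.sqrt ((1 - m / Λ) * ‖v‖ ^ 2) := Real.sqrt_le_sqrt h
      _ = q * ‖v‖ := by rw [Real.sqrt_mul hq0, Real.sqrt_sq (norm_nonneg _)]
  have hTn : ∀ n : ℕ, ∀ v, ‖(T ^ n) v‖ ≤ q ^ n * ‖v‖ := by
    intro n; induction n with
    | zero => intro v; simp
    | succ n ih =>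
        intro v
        rw [pow_succ', Module.End.mul_apply]
        calc ‖T ((T ^ n) v)‖ ≤ q * ‖(T ^ n) v‖ := hT1 _
          _ ≤ q * (q ^ n * ‖v‖) := mul_le_mul_of_nonneg_left (ih v) hqnn
          _ = q ^ (n + 1) * ‖v‖ := by ring
  have hTK : ∀ j : ℕ, (T ^ j) y ∈ K j := by
    intro j; induction j with
    | zero => simpa using hy
    | succ j ih =>
        rw [pow_succ', Module.End.mul_apply, hTapp]
        exact Submodule.sub_mem _ (hKmono j ih) (Submodule.smul_mem _ _ (hHK j _ ih))
  have hfix : u = (1 / Λ) • y + T u := by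
    rw [hTapp, hu]; abel
  have key : ∀ n ≤ N, inner ℝ x u = inner ℝ x ((T ^ n) u) := by
    intro n; induction n with
    | zero => intro _; simp
    | succ n ih =>
        intro hn
        rw [ih (Nat.le_of_succ_le hn)]
        conv_lhs => rw [hfix]
        rw [map_add, map_smul, inner_add_right, real_inner_smul_right,
          hx n (Nat.lt_of_succ_le hn) _ (hTK n), mul_zero, zero_add, ← Module.End.mul_apply, ← pow_succ]
  have hu_le : ‖u‖ ≤ ‖y‖ / m := by
    rw [le_div_iff₀ hm]
    have h1 : m * ‖u‖ ^ 2 ≤ ‖u‖ * ‖y‖ := by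
      calc m * ‖u‖ ^ 2 ≤ inner ℝ u (H u) := hgap u
        _ = inner ℝ u y := by rw [hu]
        _ ≤ ‖u‖ * ‖y‖ := real_inner_le_norm _ _
    rcases eq_or_lt_of_le (norm_nonneg u) with h0 | hpos
    · rw [← h0]; simp
    · nlinarith
  rw [key N le_rfl]
  calc |inner ℝ x ((T ^ N) u)| ≤ ‖x‖ * ‖(T ^ N) u‖ := abs_real_inner_le_norm _ _
    _ ≤ ‖x‖ * (q ^ N * ‖u‖) := mul_le_mul_of_nonneg_left (hTn N u) (norm_nonneg _)
    _ ≤ ‖x‖ * (q ^ N * (‖y‖ / m)) :=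
        mul_le_mul_of_nonneg_left (mul_le_mul_of_nonneg_left hu_le (pow_nonneg hqnn N)) (norm_nonneg _)
    _ = q ^ N * (‖x‖ * ‖y‖ / m) := by ring

/-- Summation form of (B): a response to finitely many localized sources `y i ∈ K i 0` at depths `N i` from `x`.
[folklore] -/
theorem local_response_decay_sum {ι : Type*} (s : Finset ι) (H : V →ₗ[ℝ] V) {m Λ : ℝ} (hm : 0 < m)
    (hmΛ : m ≤ Λ) (hgap : ∀ v, m * ‖v‖ ^ 2 ≤ inner ℝ v (H v)) (hup : ∀ v, ‖H v‖ ^ 2 ≤ Λ * inner ℝ v (H v))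
    (K : ι → ℕ → Submodule ℝ V) (hKmono : ∀ i j, K i j ≤ K i (j + 1))
    (hHK : ∀ i j, ∀ v ∈ K i j, H v ∈ K i (j + 1)) (x : V) (y u : ι → V) (hu : ∀ i ∈ s, H (u i) = y i)
    (hy : ∀ i ∈ s, y i ∈ K i 0) (N : ι → ℕ) (hx : ∀ i ∈ s, ∀ j < N i, ∀ v ∈ K i j, inner ℝ x v = 0) :
    |inner ℝ x (∑ i ∈ s, u i)| ≤ ‖x‖ / m * ∑ i ∈ s, Real.sqrt (1 - m / Λ) ^ N i * ‖y i‖ := by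
  rw [inner_sum, Finset.mul_sum]
  refine (Finset.abs_sum_le_sum_abs _ _).trans (Finset.sum_le_sum fun i hi => ?_)
  calc |inner ℝ x (u i)| ≤ Real.sqrt (1 - m / Λ) ^ N i * (‖x‖ * ‖y i‖ / m) :=
        local_response_decay H hm hmΛ hgap hup (K i) (hKmono i) (hHK i) (hu i hi) (hy i hi) (hx i hi)
    _ = ‖x‖ / m * (Real.sqrt (1 - m / Λ) ^ N i * ‖y i‖) := by ring

end Neumann

/-! ### §8c Non-vacuity of (A): on ℝ with B u v = 2uv, N = |·|, w = id, J v = 2cv the weak solution is u = c and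
the Agmon bound reads |c| ≤ 2|c|/(2 − 0) — attained. -/

section AgmonWitness

/-- The hypotheses of `agmon_weighted_response` are jointly satisfiable with equality in the conclusion
(E = ℝ, B u v = 2uv, w = id, N = |·|, J v = 2cv, u = c, m = 2, κ = 0, ρ = 2|c|). [folklore] -/
theorem agmon_witness (c : ℝ) :
    (∀ v : ℝ, (2 : ℝ) * |v| ^ 2 ≤ ((2 : ℝ) • LinearMap.mul ℝ ℝ) v v) ∧
    (∀ v : ℝ, ((2 : ℝ) • LinearMap.mul ℝ ℝ) ((LinearMap.id : ℝ →ₗ[ℝ] ℝ) v) ((LinearMap.id : ℝ →ₗ[ℝ] ℝ) v)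
        - 0 * |(LinearMap.id : ℝ →ₗ[ℝ] ℝ) v| ^ 2
        ≤ ((2 : ℝ) • LinearMap.mul ℝ ℝ) v ((LinearMap.id : ℝ →ₗ[ℝ] ℝ) ((LinearMap.id : ℝ →ₗ[ℝ] ℝ) v))) ∧
    (∀ v : ℝ, ((2 : ℝ) • LinearMap.mul ℝ ℝ) c v = (((2 : ℝ) * c) • (LinearMap.id : ℝ →ₗ[ℝ] ℝ)) v) ∧
    (∀ v : ℝ, |(((2 : ℝ) * c) • (LinearMap.id : ℝ →ₗ[ℝ] ℝ)) ((LinearMap.id : ℝ →ₗ[ℝ] ℝ) v)| ≤ (2 * |c|) * |v|) ∧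
    |(LinearMap.id : ℝ →ₗ[ℝ] ℝ) c| = (2 * |c|) / (2 - 0) := by
  refine ⟨fun v => ?_, fun v => ?_, fun v => ?_, fun v => ?_, ?_⟩
  · simp [sq]
  · simp
  · simp; ring
  · simp [abs_mul]
  · simp

end AgmonWitness

/-! ### §8d Typed shapes for the two hypotheses of the Agmon estimate (the record's typed missing inequalities (δ2)–(δ3))
and the MODEL DISCHARGE of the conjugation-defect shape on the lattice, UNIFORM IN THE MESH (v1.7)

`ConjugationDefect B w N κ` and `WeightedDualBound J w N ρ` name the two hypotheses of `agmon_weighted_response`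
(`agmon_of_shapes`); `agmon_constrained` (v1.8) is the variant with the weak equation on a subspace T only and
a corrected test vector (the block-tangent space of (82)–(83) and the H_Q-correction of the record's (δ2)).  On the
§7b lattice (ℓ²(G), G any finite abelian group, difference quotients of inverse mesh c
along any vectors e_i) the scalar model form `latticeForm c e s` (u, v) ↦ Σ_i⟨D_iu, D_iv⟩ + s⟨u, v⟩ is s-coercive
(`latticeForm_coercive`), satisfies the summed IMS identity per direction (`lattice_ims_identity`), its bond defect is
absorbed by μ²‖ωu‖² as soon as the weight is relatively Lipschitz AT THE MESH SCALE, c|ω(x+e_i) − ω(x)| ≤ μ·min(ω(x),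
ω(x+e_i)) (`lattice_ims_defect_le` — for ω = e^{−μ′φ}, φ 1-Lipschitz, μ = c(e^{μ′/c} − 1) → μ′: no mesh dependence),
hence `ConjugationDefect (latticeForm c e s) (mulOp ω) ‖·‖ (#ι·μ²)` (`latticeForm_conjugationDefect`) and the model
Agmon bound ‖ωu‖ ≤ ρ/(s − #ι·μ²) for weak solutions (`lattice_agmon`).  This is the U = 1, no-constraint, scalar
analogue of item (δ3) of the record; the dressing by parallel transport, the constraint correction (δ2) and the
gauge-invariant coercivity (δ4) are NOT here. [cite: Balaban1985Variational, (79) p. 290 (context)] -/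

section Shapes

variable {E : Type*} [AddCommGroup E] [Module ℝ E]

/-- HYPOTHESIS SHAPE (the typed missing inequality (δ2)–(δ3) of the record): the CONJUGATION DEFECT of the weight
map `w` on the form `B`, measured in the gauge `N`, is at most `κ`. [folklore] -/
def ConjugationDefect (B : E →ₗ[ℝ] E →ₗ[ℝ] ℝ) (w : E →ₗ[ℝ] E) (N : E → ℝ) (κ : ℝ) : Prop :=
  ∀ v, B (w v) (w v) - κ * N (w v) ^ 2 ≤ B v (w (w v))

/-- HYPOTHESIS SHAPE: the `w`-weighted dual gauge of the source `J` is at most `ρ`. [folklore] -/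
def WeightedDualBound (J : E →ₗ[ℝ] ℝ) (w : E →ₗ[ℝ] E) (N : E → ℝ) (ρ : ℝ) : Prop :=
  ∀ v, |J (w v)| ≤ ρ * N v

/-- `agmon_weighted_response` over the two shapes. [folklore] -/
theorem agmon_of_shapes (B : E →ₗ[ℝ] E →ₗ[ℝ] ℝ) (w : E →ₗ[ℝ] E) (N : E → ℝ) (J : E →ₗ[ℝ] ℝ)
    {m κ ρ : ℝ} (hκ : κ < m) (hρ : 0 ≤ ρ) (hcoer : ∀ v, m * N v ^ 2 ≤ B v v)
    (hAg : ConjugationDefect B w N κ) {u : E} (hweak : ∀ v, B u v = J v) (hJ : WeightedDualBound J w N ρ)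
    (hN : 0 ≤ N (w u)) : N (w u) ≤ ρ / (m - κ) :=
  agmon_weighted_response B w N J hκ hρ hcoer hAg hweak hJ hN

/-- CONSTRAINED AGMON ESTIMATE (the shape of (δ1)+(δ2)): the weak equation holds only on a subspace `T` (the
block-tangent space), the Agmon test vector `w (w u)` is NOT in `T` but is corrected into it by a linear map `corr`
(`w (w u) − corr u ∈ T`; dictionary: corr = H_Q ∘ Q_k ∘ (ω² − ω̄²)), at a cost quadratic in `N (w u)` on the form side
(`|B u (corr u)| ≤ κ₂ N(wu)²`, κ₂ = O(Λ_E μ)) and linear on the source side (`|J (corr u)| ≤ ρ₂ N(wu)`).  Then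
N(wu) ≤ (ρ + ρ₂)/(m − κ − κ₂). [folklore]
[cite: Balaban1985Variational, (82)–(83) p. 290 (context: the weak equation holds for δA with QδA = 0, RD*δA = 0)] -/
theorem agmon_constrained (B : E →ₗ[ℝ] E →ₗ[ℝ] ℝ) (w corr : E →ₗ[ℝ] E) (T : Submodule ℝ E) (N : E → ℝ)
    (J : E →ₗ[ℝ] ℝ) {m κ κ₂ ρ ρ₂ : ℝ} (hm : κ + κ₂ < m) (hρ : 0 ≤ ρ + ρ₂)
    (hcoer : ∀ v, m * N v ^ 2 ≤ B v v) (hAg : ConjugationDefect B w N κ) {u : E}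
    (htest : w (w u) - corr u ∈ T) (hweak : ∀ v ∈ T, B u v = J v)
    (hBcorr : |B u (corr u)| ≤ κ₂ * N (w u) ^ 2) (hJcorr : |J (corr u)| ≤ ρ₂ * N (w u))
    (hJ : WeightedDualBound J w N ρ) (hN : 0 ≤ N (w u)) :
    N (w u) ≤ (ρ + ρ₂) / (m - κ - κ₂) := by
  have hmk : 0 < m - κ - κ₂ := by linarith
  have hsplit : B u (w (w u)) = J (w (w u)) - J (corr u) + B u (corr u) := by
    have h1 : B u (w (w u)) = B u (w (w u) - corr u) + B u (corr u) := by
      rw [map_sub]; ring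
    rw [h1, hweak _ htest, map_sub]
  have h1 : (m - κ - κ₂) * N (w u) ^ 2 ≤ (ρ + ρ₂) * N (w u) := by
    have hA := hAg u
    have hc := hcoer (w u)
    have hJ1 := hJ (w u)
    have e1 : J (w (w u)) ≤ ρ * N (w u) := (le_abs_self _).trans hJ1
    have e2 : -J (corr u) ≤ ρ₂ * N (w u) := (neg_le_abs _).trans hJcorr
    have e3 : B u (corr u) ≤ κ₂ * N (w u) ^ 2 := (le_abs_self _).trans hBcorr
    rw [hsplit] at hA
    nlinarith
  rw [le_div_iff₀ hmk]
  rcases eq_or_lt_of_le hN with h0 | hpos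
  · rw [← h0]; simp; exact hρ
  · nlinarith

end Shapes

namespace LatticeWitness

variable {G : Type*} [AddCommGroup G] [Fintype G] {ι : Type*} [Fintype ι]

/-- The scalar lattice model form B u v = Σ_i ⟨D_i u, D_i v⟩ + s⟨u, v⟩ (covariant Laplacian at U = 1 plus a mass
s — the shape of the leading part of (79) in the axial/Landau gauge at unit background). [folklore]
[cite: Balaban1985Variational, (79) p. 290 (context)] -/
def latticeForm (c : ℝ) (e : ι → G) (s : ℝ) :
    EuclideanSpace ℝ G →ₗ[ℝ] EuclideanSpace ℝ G →ₗ[ℝ] ℝ :=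
  ∑ i, (innerₗ (EuclideanSpace ℝ G)).compl₁₂ (fwdDiff c e i) (fwdDiff c e i) + s • innerₗ (EuclideanSpace ℝ G)

/-- Evaluation of the model form. [folklore] [cite: Balaban1985Variational, (79) p. 290 (context)] -/
theorem latticeForm_apply (c : ℝ) (e : ι → G) (s : ℝ) (u v : EuclideanSpace ℝ G) :
    latticeForm c e s u v = ∑ i, inner ℝ (fwdDiff c e i u) (fwdDiff c e i v) + s * inner ℝ u v := by
  simp [latticeForm, LinearMap.sum_apply, LinearMap.add_apply, LinearMap.smul_apply, LinearMap.compl₁₂_apply,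
    innerₗ_apply_apply]

/-- Coercivity of the model form with modulus the mass: B v v ≥ s‖v‖². [folklore]
[cite: Balaban1985Variational, (79) p. 290 (context)] -/
theorem latticeForm_coercive (c : ℝ) (e : ι → G) (s : ℝ) (v : EuclideanSpace ℝ G) :
    s * ‖v‖ ^ 2 ≤ latticeForm c e s v v := by
  rw [latticeForm_apply, real_inner_self_eq_norm_sq]
  have : 0 ≤ ∑ i, inner ℝ (fwdDiff c e i v) (fwdDiff c e i v) :=
    Finset.sum_nonneg fun i _ => real_inner_self_nonneg
  linarith

omit [Fintype ι] in
/-- THE LATTICE IMS IDENTITY along one direction (sum of `ims_bond_identity` over the bonds):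
⟨D_i u, D_i(ω²u)⟩ = ‖D_i(ωu)‖² − Σ_x c²(ω(x+e_i) − ω(x))²·u(x)u(x+e_i). [folklore]
[cite: Balaban1985Variational, (79) p. 290 (context)] -/
theorem lattice_ims_identity (c : ℝ) (e : ι → G) (i : ι) (ω : G → ℝ) (u : EuclideanSpace ℝ G) :
    inner ℝ (fwdDiff c e i u) (fwdDiff c e i (mulOp ω (mulOp ω u))) =
      ‖fwdDiff c e i (mulOp ω u)‖ ^ 2 - ∑ x, c ^ 2 * (ω (x + e i) - ω x) ^ 2 * (u x * u (x + e i)) := by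
  rw [← real_inner_self_eq_norm_sq]
  simp only [PiLp.inner_apply, fwdDiff_apply, mulOp_apply, RCLike.inner_apply, conj_trivial]
  rw [← Finset.sum_sub_distrib]
  exact Finset.sum_congr rfl (fun x _ => by ring)

omit [Fintype ι] in
/-- The bond defect is absorbed by the weighted norm when ω is RELATIVELY LIPSCHITZ AT THE MESH SCALE:
c²(ω(x+e_i) − ω(x))² ≤ μ²ω(x)² and ≤ μ²ω(x+e_i)² for all x (for ω = e^{−μ′φ}, φ 1-Lipschitz, this holds with
μ = c(e^{μ′/c} − 1) ≈ μ′, UNIFORMLY in the mesh 1/c) ⇒ |Σ_x c²(Δ_iω)² u(x)u(x+e_i)| ≤ μ²‖ωu‖². [folklore]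
[cite: Balaban1985Variational, (79) p. 290 (context)] -/
theorem lattice_ims_defect_le (c : ℝ) (e : ι → G) (i : ι) (ω : G → ℝ) {μ : ℝ}
    (hω : ∀ x, c ^ 2 * (ω (x + e i) - ω x) ^ 2 ≤ μ ^ 2 * ω x ^ 2 ∧
      c ^ 2 * (ω (x + e i) - ω x) ^ 2 ≤ μ ^ 2 * ω (x + e i) ^ 2) (u : EuclideanSpace ℝ G) :
    |∑ x, c ^ 2 * (ω (x + e i) - ω x) ^ 2 * (u x * u (x + e i))| ≤ μ ^ 2 * ‖mulOp ω u‖ ^ 2 := by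
  have hnorm : ‖mulOp ω u‖ ^ 2 = ∑ x, (ω x * u x) ^ 2 := by
    rw [← real_inner_self_eq_norm_sq]
    simp only [PiLp.inner_apply, mulOp_apply, RCLike.inner_apply, conj_trivial]
    exact Finset.sum_congr rfl (fun x _ => by ring)
  have hshift : ∑ x, (ω (x + e i) * u (x + e i)) ^ 2 = ∑ x, (ω x * u x) ^ 2 :=
    Fintype.sum_equiv (Equiv.addRight (e i)) _ _ (fun x => rfl)
  refine (Finset.abs_sum_le_sum_abs _ _).trans ?_
  have hterm : ∀ x, |c ^ 2 * (ω (x + e i) - ω x) ^ 2 * (u x * u (x + e i))| ≤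
      (μ ^ 2 / 2) * ((ω x * u x) ^ 2 + (ω (x + e i) * u (x + e i)) ^ 2) := by
    intro x
    obtain ⟨h1, h2⟩ := hω x
    rw [abs_mul, abs_of_nonneg (by positivity : 0 ≤ c ^ 2 * (ω (x + e i) - ω x) ^ 2), abs_mul]
    have hk : 0 ≤ c ^ 2 * (ω (x + e i) - ω x) ^ 2 := by positivity
    have hab : c ^ 2 * (ω (x + e i) - ω x) ^ 2 * (|u x| * |u (x + e i)|) ≤
        (c ^ 2 * (ω (x + e i) - ω x) ^ 2) * ((u x ^ 2 + u (x + e i) ^ 2) / 2) := by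
      refine mul_le_mul_of_nonneg_left ?_ hk
      nlinarith [sq_nonneg (|u x| - |u (x + e i)|), sq_abs (u x), sq_abs (u (x + e i))]
    have h3 : (c ^ 2 * (ω (x + e i) - ω x) ^ 2) * u x ^ 2 ≤ μ ^ 2 * ω x ^ 2 * u x ^ 2 :=
      mul_le_mul_of_nonneg_right h1 (sq_nonneg _)
    have h4 : (c ^ 2 * (ω (x + e i) - ω x) ^ 2) * u (x + e i) ^ 2 ≤ μ ^ 2 * ω (x + e i) ^ 2 * u (x + e i) ^ 2 :=
      mul_le_mul_of_nonneg_right h2 (sq_nonneg _)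
    calc c ^ 2 * (ω (x + e i) - ω x) ^ 2 * (|u x| * |u (x + e i)|)
        ≤ (c ^ 2 * (ω (x + e i) - ω x) ^ 2) * ((u x ^ 2 + u (x + e i) ^ 2) / 2) := hab
      _ = ((c ^ 2 * (ω (x + e i) - ω x) ^ 2) * u x ^ 2 + (c ^ 2 * (ω (x + e i) - ω x) ^ 2) * u (x + e i) ^ 2) / 2 := by
          ring
      _ ≤ (μ ^ 2 * ω x ^ 2 * u x ^ 2 + μ ^ 2 * ω (x + e i) ^ 2 * u (x + e i) ^ 2) / 2 := by linarith
      _ = (μ ^ 2 / 2) * ((ω x * u x) ^ 2 + (ω (x + e i) * u (x + e i)) ^ 2) := by ring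
  calc ∑ x, |c ^ 2 * (ω (x + e i) - ω x) ^ 2 * (u x * u (x + e i))|
      ≤ ∑ x, (μ ^ 2 / 2) * ((ω x * u x) ^ 2 + (ω (x + e i) * u (x + e i)) ^ 2) := Finset.sum_le_sum fun x _ => hterm x
    _ = (μ ^ 2 / 2) * (∑ x, (ω x * u x) ^ 2 + ∑ x, (ω (x + e i) * u (x + e i)) ^ 2) := by
        rw [← Finset.mul_sum, Finset.sum_add_distrib]
    _ = μ ^ 2 * ‖mulOp ω u‖ ^ 2 := by rw [hshift, hnorm]; ring

/-- THE MODEL DISCHARGE OF THE CONJUGATION-DEFECT SHAPE, UNIFORM IN THE MESH: for the scalar lattice form and a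
weight ω relatively Lipschitz at the mesh scale with constant μ, `ConjugationDefect (latticeForm c e s) (mulOp ω) ‖·‖
((#directions)·μ²)` — the mass term commutes with ω exactly, each direction contributes the IMS bond defect. [folklore]
[cite: Balaban1985Variational, (79) p. 290 (context)] -/
theorem latticeForm_conjugationDefect (c : ℝ) (e : ι → G) (s : ℝ) (ω : G → ℝ) {μ : ℝ}
    (hω : ∀ i x, c ^ 2 * (ω (x + e i) - ω x) ^ 2 ≤ μ ^ 2 * ω x ^ 2 ∧
      c ^ 2 * (ω (x + e i) - ω x) ^ 2 ≤ μ ^ 2 * ω (x + e i) ^ 2) :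
    ConjugationDefect (latticeForm c e s) (mulOp ω) (fun v => ‖v‖) (Fintype.card ι * μ ^ 2) := by
  intro u
  rw [latticeForm_apply, latticeForm_apply]
  have hmass : inner ℝ u (mulOp ω (mulOp ω u)) = inner ℝ (mulOp ω u) (mulOp ω u) := by
    rw [← mulOp_symm]
  rw [hmass]
  have hdir : ∀ i, inner ℝ (fwdDiff c e i (mulOp ω u)) (fwdDiff c e i (mulOp ω u)) - μ ^ 2 * ‖mulOp ω u‖ ^ 2 ≤
      inner ℝ (fwdDiff c e i u) (fwdDiff c e i (mulOp ω (mulOp ω u))) := by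
    intro i
    rw [lattice_ims_identity, real_inner_self_eq_norm_sq]
    have h := lattice_ims_defect_le c e i ω (hω i) u
    have h' := (abs_le.mp h).2
    linarith [(abs_le.mp h).1]
  have hsum := Finset.sum_le_sum fun i (_ : i ∈ Finset.univ) => hdir i
  rw [Finset.sum_sub_distrib, Finset.sum_const, Finset.card_univ, nsmul_eq_mul] at hsum
  linarith

/-- MODEL AGMON ESTIMATE (all hypotheses of `agmon_weighted_response` discharged in the scalar lattice model except
the source bound, uniformly in the mesh): a weak solution of `latticeForm c e s u · = J` with |J(ωv)| ≤ ρ‖v‖ obeys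
‖ωu‖ ≤ ρ/(s − dμ²) whenever dμ² < s. [folklore] [cite: Balaban1985Variational, (79) p. 290 (context)] -/
theorem lattice_agmon (c : ℝ) (e : ι → G) {s μ ρ : ℝ} (ω : G → ℝ)
    (hω : ∀ i x, c ^ 2 * (ω (x + e i) - ω x) ^ 2 ≤ μ ^ 2 * ω x ^ 2 ∧
      c ^ 2 * (ω (x + e i) - ω x) ^ 2 ≤ μ ^ 2 * ω (x + e i) ^ 2)
    (hκ : Fintype.card ι * μ ^ 2 < s) (hρ : 0 ≤ ρ) {u : EuclideanSpace ℝ G} (J : EuclideanSpace ℝ G →ₗ[ℝ] ℝ)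
    (hweak : ∀ v, latticeForm c e s u v = J v) (hJ : ∀ v, |J (mulOp ω v)| ≤ ρ * ‖v‖) :
    ‖mulOp ω u‖ ≤ ρ / (s - Fintype.card ι * μ ^ 2) :=
  agmon_weighted_response (latticeForm c e s) (mulOp ω) (fun v => ‖v‖) J hκ hρ (latticeForm_coercive c e s)
    (latticeForm_conjugationDefect c e s ω hω) hweak hJ (norm_nonneg _)

end LatticeWitness

/-! ### §8e Item (δ3) DRESSED BY PARALLEL TRANSPORT (v1.9): the covariant difference form on F-valued fields

The D_{U₀}-part of the quadratic form (79) is a COVARIANT nearest-neighbour difference form: (D^R_iu)(x) =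
c(R_i(x)u(x + e_i) − u(x)) with R_i(x) the adjoint action of the parallel transport on the fibre 𝔤 — a linear
ISOMETRY.  Transport is fibrewise linear and commutes with REAL weights, so the IMS identity and the bond-defect bound
of §8d survive verbatim with the bond product ⟨u(x), R_i(x)u(x+e_i)⟩ (`ims_vec_identity`, `dressed_ims_identity`,
`dressed_ims_defect_le` — the isometry enters only through |⟨a, Rb⟩| ≤ ‖a‖‖b‖), whence
`ConjugationDefect (latticeFormR c e R s) (mulOpF ω) ‖·‖ (#ι·μ²)` for ANY isometric transports and any weight
relatively Lipschitz at the mesh scale (`latticeFormR_conjugationDefect`) and the dressed model Agmon bound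
(`dressed_lattice_agmon`).  Fields are F-valued, F any real inner product space (`PiLp 2 (fun _ : G => F)`).  What is
still NOT here of (δ3): the finite-range block terms HD(A′)/Δ_π/V of (80) and the Landau-gauge term of (79); and
(δ1), (δ2), (δ4) beyond their abstract shapes. [cite: Balaban1985Variational, (79) p. 290 (context)] -/

namespace LatticeWitness

/-- Pointwise core of the dressed IMS identity in any real inner product space: with b the transported neighbour
value, ⟨c(b − a), c(β²b − α²a)⟩ = ‖c(βb − αa)‖² − c²(β − α)²⟨a, b⟩. [folklore]
[cite: Balaban1985Variational, (79) p. 290 (context)] -/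
theorem ims_vec_identity {F : Type*} [NormedAddCommGroup F] [InnerProductSpace ℝ F] (a b : F) (α β c : ℝ) :
    inner ℝ (c • (b - a)) (c • ((β * β) • b - (α * α) • a)) =
      ‖c • (β • b - α • a)‖ ^ 2 - c ^ 2 * (β - α) ^ 2 * inner ℝ a b := by
  rw [← real_inner_self_eq_norm_sq]
  simp only [inner_smul_left, inner_smul_right, inner_sub_left, inner_sub_right, RCLike.conj_to_real,
    real_inner_comm a b]
  ring

variable {G : Type*} [AddCommGroup G] [Fintype G] {ι : Type*} {F : Type*} [NormedAddCommGroup F]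
  [InnerProductSpace ℝ F]

/-- DRESSED (covariant) translation of F-valued lattice fields: (τ^R_i f)(x) = R_i(x)·f(x + e_i) with R_i(x) a linear
isometry of the fibre (dictionary: the adjoint action of the parallel transport U₀(x, x + e_i) on 𝔤 — the D_{U₀} of
B11 (79)). [folklore] [cite: Balaban1985Variational, (79) p. 290 (context)] -/
def shiftR (e : ι → G) (R : ι → G → (F →ₗᵢ[ℝ] F)) (i : ι) :
    PiLp 2 (fun _ : G => F) →ₗ[ℝ] PiLp 2 (fun _ : G => F) where
  toFun f := WithLp.toLp 2 (fun x => R i x (f (x + e i)))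
  map_add' f g := by ext x; simp [PiLp.add_apply]
  map_smul' c f := by ext x; simp [PiLp.smul_apply]

omit [Fintype G] in
/-- Pointwise action. [folklore] [cite: Balaban1985Variational, (79) p. 290 (context)] -/
@[simp] theorem shiftR_apply (e : ι → G) (R : ι → G → (F →ₗᵢ[ℝ] F)) (i : ι) (f : PiLp 2 (fun _ : G => F))
    (x : G) : shiftR e R i f x = R i x (f (x + e i)) := rfl

/-- Multiplication of F-valued fields by a real weight. [folklore] [cite: Balaban1985Variational, (79) p. 290 (context)] -/
def mulOpF (ω : G → ℝ) : PiLp 2 (fun _ : G => F) →ₗ[ℝ] PiLp 2 (fun _ : G => F) where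
  toFun f := WithLp.toLp 2 (fun x => ω x • f x)
  map_add' f g := by ext x; simp [PiLp.add_apply]
  map_smul' c f := by ext x; simp [PiLp.smul_apply, smul_comm (ω x) c]

omit [AddCommGroup G] [Fintype G] in
/-- Pointwise action. [folklore] [cite: Balaban1985Variational, (79) p. 290 (context)] -/
@[simp] theorem mulOpF_apply (ω : G → ℝ) (f : PiLp 2 (fun _ : G => F)) (x : G) : mulOpF ω f x = ω x • f x := rfl

omit [AddCommGroup G] in
/-- Real weights are symmetric. [folklore] [cite: Balaban1985Variational, (79) p. 290 (context)] -/
theorem mulOpF_symm (ω : G → ℝ) (f g : PiLp 2 (fun _ : G => F)) :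
    inner ℝ (mulOpF ω f) g = inner ℝ f (mulOpF ω g) := by
  simp only [PiLp.inner_apply, mulOpF_apply, inner_smul_left, inner_smul_right, RCLike.conj_to_real]

omit [AddCommGroup G] in
/-- ‖ωf‖² = Σ_x ω(x)²‖f(x)‖². [folklore] [cite: Balaban1985Variational, (79) p. 290 (context)] -/
theorem norm_sq_mulOpF (ω : G → ℝ) (f : PiLp 2 (fun _ : G => F)) :
    ‖mulOpF ω f‖ ^ 2 = ∑ x, (ω x * ‖f x‖) ^ 2 := by
  rw [PiLp.norm_sq_eq_of_L2]
  exact Finset.sum_congr rfl (fun x _ => by rw [mulOpF_apply, norm_smul, Real.norm_eq_abs, mul_pow, mul_pow, sq_abs])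

/-- The DRESSED forward difference quotient D^R_i = c(τ^R_i − 1) (the covariant derivative D_{U₀} along e_i, inverse
mesh c). [folklore] [cite: Balaban1985Variational, (79) p. 290 (context)] -/
def fwdDiffR (c : ℝ) (e : ι → G) (R : ι → G → (F →ₗᵢ[ℝ] F)) (i : ι) :
    PiLp 2 (fun _ : G => F) →ₗ[ℝ] PiLp 2 (fun _ : G => F) :=
  c • (shiftR e R i - LinearMap.id)

omit [Fintype G] in
/-- Pointwise action: (D^R_i f)(x) = c(R_i(x)f(x + e_i) − f(x)). [folklore] [cite: Balaban1985Variational, (79) p. 290 (context)] -/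
@[simp] theorem fwdDiffR_apply (c : ℝ) (e : ι → G) (R : ι → G → (F →ₗᵢ[ℝ] F)) (i : ι)
    (f : PiLp 2 (fun _ : G => F)) (x : G) : fwdDiffR c e R i f x = c • (R i x (f (x + e i)) - f x) := by
  simp [fwdDiffR, PiLp.sub_apply, PiLp.smul_apply]

/-- THE DRESSED LATTICE IMS IDENTITY: parallel transport is fibrewise linear and commutes with REAL weights, so the
scalar identity survives verbatim with the bond product ⟨u(x), R_i(x)u(x + e_i)⟩:
⟨D^R_iu, D^R_i(ω²u)⟩ = ‖D^R_i(ωu)‖² − Σ_x c²(ω(x+e_i) − ω(x))²⟨u(x), R_i(x)u(x+e_i)⟩. [folklore]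
[cite: Balaban1985Variational, (79) p. 290 (context)] -/
theorem dressed_ims_identity (c : ℝ) (e : ι → G) (R : ι → G → (F →ₗᵢ[ℝ] F)) (i : ι) (ω : G → ℝ)
    (u : PiLp 2 (fun _ : G => F)) :
    inner ℝ (fwdDiffR c e R i u) (fwdDiffR c e R i (mulOpF ω (mulOpF ω u))) =
      ‖fwdDiffR c e R i (mulOpF ω u)‖ ^ 2
        - ∑ x, c ^ 2 * (ω (x + e i) - ω x) ^ 2 * inner ℝ (u x) (R i x (u (x + e i))) := by
  rw [PiLp.norm_sq_eq_of_L2, PiLp.inner_apply, ← Finset.sum_sub_distrib]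
  refine Finset.sum_congr rfl (fun x _ => ?_)
  have h := ims_vec_identity (u x) (R i x (u (x + e i))) (ω x) (ω (x + e i)) c
  simp only [fwdDiffR_apply, mulOpF_apply, map_smul, smul_smul]
  rw [h]

/-- The dressed bond defect is absorbed exactly as in the scalar case, because |⟨u(x), R u(x+e_i)⟩| ≤ ‖u(x)‖‖u(x+e_i)‖
for an isometry R: weight relatively Lipschitz at the mesh scale ⇒ |defect| ≤ μ²‖ωu‖². [folklore]
[cite: Balaban1985Variational, (79) p. 290 (context)] -/
theorem dressed_ims_defect_le (c : ℝ) (e : ι → G) (R : ι → G → (F →ₗᵢ[ℝ] F)) (i : ι) (ω : G → ℝ) {μ : ℝ}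
    (hω : ∀ x, c ^ 2 * (ω (x + e i) - ω x) ^ 2 ≤ μ ^ 2 * ω x ^ 2 ∧
      c ^ 2 * (ω (x + e i) - ω x) ^ 2 ≤ μ ^ 2 * ω (x + e i) ^ 2) (u : PiLp 2 (fun _ : G => F)) :
    |∑ x, c ^ 2 * (ω (x + e i) - ω x) ^ 2 * inner ℝ (u x) (R i x (u (x + e i)))| ≤ μ ^ 2 * ‖mulOpF ω u‖ ^ 2 := by
  have hnorm : ‖mulOpF ω u‖ ^ 2 = ∑ x, (ω x * ‖u x‖) ^ 2 := norm_sq_mulOpF ω u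
  have hshift : ∑ x, (ω (x + e i) * ‖u (x + e i)‖) ^ 2 = ∑ x, (ω x * ‖u x‖) ^ 2 :=
    Fintype.sum_equiv (Equiv.addRight (e i)) _ _ (fun x => rfl)
  refine (Finset.abs_sum_le_sum_abs _ _).trans ?_
  have hterm : ∀ x, |c ^ 2 * (ω (x + e i) - ω x) ^ 2 * inner ℝ (u x) (R i x (u (x + e i)))| ≤
      (μ ^ 2 / 2) * ((ω x * ‖u x‖) ^ 2 + (ω (x + e i) * ‖u (x + e i)‖) ^ 2) := by
    intro x
    obtain ⟨h1, h2⟩ := hω x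
    have hk : 0 ≤ c ^ 2 * (ω (x + e i) - ω x) ^ 2 := by positivity
    rw [abs_mul, abs_of_nonneg hk]
    have hin : |inner ℝ (u x) (R i x (u (x + e i)))| ≤ ‖u x‖ * ‖u (x + e i)‖ := by
      have := abs_real_inner_le_norm (u x) (R i x (u (x + e i)))
      rwa [LinearIsometry.norm_map] at this
    have hab : c ^ 2 * (ω (x + e i) - ω x) ^ 2 * |inner ℝ (u x) (R i x (u (x + e i)))| ≤
        (c ^ 2 * (ω (x + e i) - ω x) ^ 2) * ((‖u x‖ ^ 2 + ‖u (x + e i)‖ ^ 2) / 2) := by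
      refine mul_le_mul_of_nonneg_left (hin.trans ?_) hk
      nlinarith [sq_nonneg (‖u x‖ - ‖u (x + e i)‖)]
    have h3 : (c ^ 2 * (ω (x + e i) - ω x) ^ 2) * ‖u x‖ ^ 2 ≤ μ ^ 2 * ω x ^ 2 * ‖u x‖ ^ 2 :=
      mul_le_mul_of_nonneg_right h1 (sq_nonneg _)
    have h4 : (c ^ 2 * (ω (x + e i) - ω x) ^ 2) * ‖u (x + e i)‖ ^ 2 ≤
        μ ^ 2 * ω (x + e i) ^ 2 * ‖u (x + e i)‖ ^ 2 :=
      mul_le_mul_of_nonneg_right h2 (sq_nonneg _)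
    calc c ^ 2 * (ω (x + e i) - ω x) ^ 2 * |inner ℝ (u x) (R i x (u (x + e i)))|
        ≤ (c ^ 2 * (ω (x + e i) - ω x) ^ 2) * ((‖u x‖ ^ 2 + ‖u (x + e i)‖ ^ 2) / 2) := hab
      _ = ((c ^ 2 * (ω (x + e i) - ω x) ^ 2) * ‖u x‖ ^ 2
            + (c ^ 2 * (ω (x + e i) - ω x) ^ 2) * ‖u (x + e i)‖ ^ 2) / 2 := by ring
      _ ≤ (μ ^ 2 * ω x ^ 2 * ‖u x‖ ^ 2 + μ ^ 2 * ω (x + e i) ^ 2 * ‖u (x + e i)‖ ^ 2) / 2 := by linarith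
      _ = (μ ^ 2 / 2) * ((ω x * ‖u x‖) ^ 2 + (ω (x + e i) * ‖u (x + e i)‖) ^ 2) := by ring
  calc ∑ x, |c ^ 2 * (ω (x + e i) - ω x) ^ 2 * inner ℝ (u x) (R i x (u (x + e i)))|
      ≤ ∑ x, (μ ^ 2 / 2) * ((ω x * ‖u x‖) ^ 2 + (ω (x + e i) * ‖u (x + e i)‖) ^ 2) :=
        Finset.sum_le_sum fun x _ => hterm x
    _ = (μ ^ 2 / 2) * (∑ x, (ω x * ‖u x‖) ^ 2 + ∑ x, (ω (x + e i) * ‖u (x + e i)‖) ^ 2) := by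
        rw [← Finset.mul_sum, Finset.sum_add_distrib]
    _ = μ ^ 2 * ‖mulOpF ω u‖ ^ 2 := by rw [hshift, hnorm]; ring

variable [Fintype ι]

/-- The DRESSED model form B u v = Σ_i⟨D^R_iu, D^R_iv⟩ + s⟨u, v⟩ — the shape of the D_{U₀}-part of the quadratic form
(79) with a mass. [folklore] [cite: Balaban1985Variational, (79) p. 290 (context)] -/
def latticeFormR (c : ℝ) (e : ι → G) (R : ι → G → (F →ₗᵢ[ℝ] F)) (s : ℝ) :
    PiLp 2 (fun _ : G => F) →ₗ[ℝ] PiLp 2 (fun _ : G => F) →ₗ[ℝ] ℝ :=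
  ∑ i, (innerₗ (PiLp 2 (fun _ : G => F))).compl₁₂ (fwdDiffR c e R i) (fwdDiffR c e R i)
    + s • innerₗ (PiLp 2 (fun _ : G => F))

/-- Evaluation. [folklore] [cite: Balaban1985Variational, (79) p. 290 (context)] -/
theorem latticeFormR_apply (c : ℝ) (e : ι → G) (R : ι → G → (F →ₗᵢ[ℝ] F)) (s : ℝ)
    (u v : PiLp 2 (fun _ : G => F)) :
    latticeFormR c e R s u v = ∑ i, inner ℝ (fwdDiffR c e R i u) (fwdDiffR c e R i v) + s * inner ℝ u v := by
  simp [latticeFormR, LinearMap.sum_apply, LinearMap.add_apply, LinearMap.smul_apply, LinearMap.compl₁₂_apply,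
    innerₗ_apply_apply]

/-- Coercivity with modulus the mass. [folklore] [cite: Balaban1985Variational, (79) p. 290 (context)] -/
theorem latticeFormR_coercive (c : ℝ) (e : ι → G) (R : ι → G → (F →ₗᵢ[ℝ] F)) (s : ℝ)
    (v : PiLp 2 (fun _ : G => F)) : s * ‖v‖ ^ 2 ≤ latticeFormR c e R s v v := by
  rw [latticeFormR_apply, real_inner_self_eq_norm_sq]
  have : 0 ≤ ∑ i, inner ℝ (fwdDiffR c e R i v) (fwdDiffR c e R i v) :=
    Finset.sum_nonneg fun i _ => real_inner_self_nonneg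
  linarith

/-- THE DRESSED MODEL DISCHARGE OF THE CONJUGATION-DEFECT SHAPE, UNIFORM IN THE MESH AND IN THE TRANSPORT:
`ConjugationDefect (latticeFormR c e R s) (mulOpF ω) ‖·‖ (#ι·μ²)` for ANY isometric transports R_i(x) and any weight
relatively Lipschitz at the mesh scale. [folklore] [cite: Balaban1985Variational, (79) p. 290 (context)] -/
theorem latticeFormR_conjugationDefect (c : ℝ) (e : ι → G) (R : ι → G → (F →ₗᵢ[ℝ] F)) (s : ℝ) (ω : G → ℝ)
    {μ : ℝ} (hω : ∀ i x, c ^ 2 * (ω (x + e i) - ω x) ^ 2 ≤ μ ^ 2 * ω x ^ 2 ∧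
      c ^ 2 * (ω (x + e i) - ω x) ^ 2 ≤ μ ^ 2 * ω (x + e i) ^ 2) :
    ConjugationDefect (latticeFormR c e R s) (mulOpF ω) (fun v => ‖v‖) (Fintype.card ι * μ ^ 2) := by
  intro u
  rw [latticeFormR_apply, latticeFormR_apply]
  have hmass : inner ℝ u (mulOpF ω (mulOpF ω u)) = inner ℝ (mulOpF ω u) (mulOpF ω u) := by
    rw [← mulOpF_symm]
  rw [hmass]
  have hdir : ∀ i, inner ℝ (fwdDiffR c e R i (mulOpF ω u)) (fwdDiffR c e R i (mulOpF ω u))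
      - μ ^ 2 * ‖mulOpF ω u‖ ^ 2 ≤ inner ℝ (fwdDiffR c e R i u) (fwdDiffR c e R i (mulOpF ω (mulOpF ω u))) := by
    intro i
    rw [dressed_ims_identity, real_inner_self_eq_norm_sq]
    have h := dressed_ims_defect_le c e R i ω (hω i) u
    linarith [(abs_le.mp h).1, (abs_le.mp h).2]
  have hsum := Finset.sum_le_sum fun i (_ : i ∈ Finset.univ) => hdir i
  rw [Finset.sum_sub_distrib, Finset.sum_const, Finset.card_univ, nsmul_eq_mul] at hsum
  linarith

/-- DRESSED MODEL AGMON ESTIMATE: ‖ωu‖ ≤ ρ/(s − #ι·μ²) for weak solutions of the dressed form, for any isometric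
transports. [folklore] [cite: Balaban1985Variational, (79) p. 290 (context)] -/
theorem dressed_lattice_agmon (c : ℝ) (e : ι → G) (R : ι → G → (F →ₗᵢ[ℝ] F)) {s μ ρ : ℝ} (ω : G → ℝ)
    (hω : ∀ i x, c ^ 2 * (ω (x + e i) - ω x) ^ 2 ≤ μ ^ 2 * ω x ^ 2 ∧
      c ^ 2 * (ω (x + e i) - ω x) ^ 2 ≤ μ ^ 2 * ω (x + e i) ^ 2)
    (hκ : Fintype.card ι * μ ^ 2 < s) (hρ : 0 ≤ ρ) {u : PiLp 2 (fun _ : G => F)}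
    (J : PiLp 2 (fun _ : G => F) →ₗ[ℝ] ℝ) (hweak : ∀ v, latticeFormR c e R s u v = J v)
    (hJ : ∀ v, |J (mulOpF ω v)| ≤ ρ * ‖v‖) :
    ‖mulOpF ω u‖ ≤ ρ / (s - Fintype.card ι * μ ^ 2) :=
  agmon_weighted_response (latticeFormR c e R s) (mulOpF ω) (fun v => ‖v‖) J hκ hρ (latticeFormR_coercive c e R s)
    (latticeFormR_conjugationDefect c e R s ω hω) hweak hJ (norm_nonneg _)

end LatticeWitness

/-! ### §8f Item (δ3), FINITE-RANGE BLOCK TERMS (v1.10): additivity of the defect and the Schur-class kernel terms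

`conjugationDefect_add`: the conjugation defect is additive in the form, so the terms of (79)–(80) are treated one at
a time.  For a kernel term P_t(u, v) = Σ_xΣ_y t(x,y)u(x)v(y) (`kernelOp`, `kernelForm`; dictionary: the finite-range
block operators HD(A′), Δ_π and the V-terms of (80), with printed-TYPE kernel bounds): the AM–GM Schur bound
(`schur_amgm`, `kernelForm_self_le`: row/column sums of |t| ≤ T ⇒ |P_t(v,v)| ≤ T‖v‖²) and the conjugation defect
P_t(ωu, ωu) − P_t(u, ω²u) = Σ t(x,y)(ω(x) − ω(y))ω(y)u(x)u(y) ≤ K‖ωu‖² as soon as |t(x,y)(ω(x) − ω(y))ω(y)| ≤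
δ(x,y)|ω(x)||ω(y)| with row/column sums of δ ≤ K (`kernelForm_conjugationDefect`; for ω = e^{−μ′φ}, φ 1-Lipschitz,
t of range r: δ = |t|(e^{μ′r} − 1), K = (e^{μ′r} − 1)T = O(μ′r·T)).  Assembled: `lattice_agmon_perturbed` — for
B = latticeForm c e s + kernelForm t, ‖ωu‖ ≤ ρ/((s − T) − (#ι·μ² + K)).  With §8d–§8e this is the complete KERNEL
SKELETON of item (δ3) «difference form (plain or transport-dressed) + finite-range block operators»; the Landau-gauge
term of (79) is itself a difference form of this class; what remains of (δ3) is only the DICTIONARY (the printed-type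
values of T, r for Bałaban's operators). [cite: Balaban1985Variational, (79)–(80) p. 290 (context)] -/

section ShapesAdd
variable {E : Type*} [AddCommGroup E] [Module ℝ E]

/-- The conjugation defect is ADDITIVE in the form (so the terms of (79)–(80) can be treated one at a time). [folklore]
[cite: Balaban1985Variational, (79)–(80) p. 290 (context)] -/
theorem conjugationDefect_add (B₁ B₂ : E →ₗ[ℝ] E →ₗ[ℝ] ℝ) (w : E →ₗ[ℝ] E) (N : E → ℝ) {κ₁ κ₂ : ℝ}
    (h₁ : ConjugationDefect B₁ w N κ₁) (h₂ : ConjugationDefect B₂ w N κ₂) :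
    ConjugationDefect (B₁ + B₂) w N (κ₁ + κ₂) := by
  intro v
  have e1 := h₁ v
  have e2 := h₂ v
  simp only [LinearMap.add_apply]
  linarith

end ShapesAdd

namespace LatticeWitness

variable {G : Type*} [Fintype G]

/-- AM–GM SCHUR BOUND for a non-negative kernel with row and column sums ≤ K:
Σ_x Σ_y δ(x,y)|f(x)||g(y)| ≤ (K/2)(Σf² + Σg²). [folklore] [cite: Balaban1985Variational, (80) p. 290 (context: the
finite-range block operators there)] -/
theorem schur_amgm (δ : G → G → ℝ) {K : ℝ} (hδ : ∀ x y, 0 ≤ δ x y) (hrow : ∀ x, ∑ y, δ x y ≤ K)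
    (hcol : ∀ y, ∑ x, δ x y ≤ K) (f g : G → ℝ) :
    ∑ x, ∑ y, δ x y * (|f x| * |g y|) ≤ (K / 2) * (∑ x, f x ^ 2 + ∑ y, g y ^ 2) := by
  have h1 : ∑ x, ∑ y, δ x y * (|f x| * |g y|) ≤ ∑ x, ∑ y, δ x y * ((f x ^ 2 + g y ^ 2) / 2) := by
    refine Finset.sum_le_sum fun x _ => Finset.sum_le_sum fun y _ => ?_
    refine mul_le_mul_of_nonneg_left ?_ (hδ x y)
    nlinarith [sq_nonneg (|f x| - |g y|), sq_abs (f x), sq_abs (g y)]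
  have h2 : ∑ x, ∑ y, δ x y * ((f x ^ 2 + g y ^ 2) / 2) =
      (∑ x, (f x ^ 2 / 2) * ∑ y, δ x y) + ∑ y, (g y ^ 2 / 2) * ∑ x, δ x y := by
    have : ∀ x y, δ x y * ((f x ^ 2 + g y ^ 2) / 2) = (f x ^ 2 / 2) * δ x y + (g y ^ 2 / 2) * δ x y := by
      intro x y; ring
    simp only [this, Finset.sum_add_distrib, ← Finset.mul_sum]
    congr 1
    rw [Finset.sum_comm]
    simp only [← Finset.mul_sum]
  rw [h2] at h1
  have h3 : ∑ x, (f x ^ 2 / 2) * ∑ y, δ x y ≤ ∑ x, (f x ^ 2 / 2) * K :=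
    Finset.sum_le_sum fun x _ => mul_le_mul_of_nonneg_left (hrow x) (by positivity)
  have h4 : ∑ y, (g y ^ 2 / 2) * ∑ x, δ x y ≤ ∑ y, (g y ^ 2 / 2) * K :=
    Finset.sum_le_sum fun y _ => mul_le_mul_of_nonneg_left (hcol y) (by positivity)
  have e3 : ∑ x, (f x ^ 2 / 2) * K = (K / 2) * ∑ x, f x ^ 2 := by
    rw [← Finset.sum_mul, ← Finset.sum_div]; ring
  have e4 : ∑ y, (g y ^ 2 / 2) * K = (K / 2) * ∑ y, g y ^ 2 := by
    rw [← Finset.sum_mul, ← Finset.sum_div]; ring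
  linarith

/-- A kernel operator (T_t v)(x) = Σ_y t(x,y)v(y) on ℓ²(G) (dictionary: the finite-range block operators
HD(A′), Δ_π, the V-terms of (80), with their printed-type kernel bounds). [folklore]
[cite: Balaban1985Variational, (80) p. 290 (context)] -/
def kernelOp (t : G → G → ℝ) : EuclideanSpace ℝ G →ₗ[ℝ] EuclideanSpace ℝ G where
  toFun v := WithLp.toLp 2 (fun x => ∑ y, t x y * v y)
  map_add' f g := by ext x; simp [PiLp.add_apply, mul_add, Finset.sum_add_distrib]
  map_smul' c f := by ext x; simp [PiLp.smul_apply, Finset.mul_sum, mul_left_comm]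

/-- Pointwise action. [folklore] [cite: Balaban1985Variational, (80) p. 290 (context)] -/
@[simp] theorem kernelOp_apply (t : G → G → ℝ) (v : EuclideanSpace ℝ G) (x : G) :
    kernelOp t v x = ∑ y, t x y * v y := rfl

/-- The form P_t(u, v) = ⟨u, T_t v⟩ = Σ_x Σ_y t(x,y)u(x)v(y). [folklore] [cite: Balaban1985Variational, (80) p. 290 (context)] -/
def kernelForm (t : G → G → ℝ) : EuclideanSpace ℝ G →ₗ[ℝ] EuclideanSpace ℝ G →ₗ[ℝ] ℝ :=
  (innerₗ (EuclideanSpace ℝ G)).compl₁₂ LinearMap.id (kernelOp t)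

/-- Evaluation. [folklore] [cite: Balaban1985Variational, (80) p. 290 (context)] -/
theorem kernelForm_apply (t : G → G → ℝ) (u v : EuclideanSpace ℝ G) :
    kernelForm t u v = ∑ x, ∑ y, t x y * u x * v y := by
  simp only [kernelForm, LinearMap.compl₁₂_apply, LinearMap.id_apply, innerₗ_apply_apply, PiLp.inner_apply,
    kernelOp_apply, RCLike.inner_apply, conj_trivial]
  refine Finset.sum_congr rfl fun x _ => ?_
  simp only [Finset.sum_mul]
  exact Finset.sum_congr rfl fun y _ => by ring

/-- SCHUR BOUND of the kernel form: row/column sums of |t| ≤ T ⇒ |P_t(v, v)| ≤ T‖v‖² (what keeps B₀ + P_t coercive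
with modulus s − T). [folklore] [cite: Balaban1985Variational, (80) p. 290 (context)] -/
theorem kernelForm_self_le (t : G → G → ℝ) {T : ℝ} (hrow : ∀ x, ∑ y, |t x y| ≤ T) (hcol : ∀ y, ∑ x, |t x y| ≤ T)
    (v : EuclideanSpace ℝ G) : |kernelForm t v v| ≤ T * ‖v‖ ^ 2 := by
  rw [kernelForm_apply]
  have hn : ‖v‖ ^ 2 = ∑ x, v x ^ 2 := by
    rw [PiLp.norm_sq_eq_of_L2]; exact Finset.sum_congr rfl fun x _ => by rw [Real.norm_eq_abs, sq_abs]
  refine (Finset.abs_sum_le_sum_abs _ _).trans ?_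
  refine (Finset.sum_le_sum fun x _ => Finset.abs_sum_le_sum_abs _ _).trans ?_
  have h := schur_amgm (fun x y => |t x y|) (fun x y => abs_nonneg _) hrow hcol (fun x => v x) (fun x => v x)
  calc ∑ x, ∑ y, |t x y * v x * v y| = ∑ x, ∑ y, |t x y| * (|v x| * |v y|) := by
        simp only [abs_mul]; exact Finset.sum_congr rfl fun x _ => Finset.sum_congr rfl fun y _ => by ring
    _ ≤ (T / 2) * (∑ x, v x ^ 2 + ∑ y, v y ^ 2) := h
    _ = T * ‖v‖ ^ 2 := by rw [hn]; ring

variable [AddCommGroup G]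

omit [AddCommGroup G] in
/-- CONJUGATION DEFECT OF A FINITE-RANGE KERNEL TERM: P_t(ωu, ωu) − P_t(u, ω²u) = Σ t(x,y)(ω(x) − ω(y))ω(y)u(x)u(y), and
if |t(x,y)(ω(x) − ω(y))ω(y)| ≤ δ(x,y)|ω(x)||ω(y)| with row/column sums of δ ≤ K (for ω = e^{−μ′φ}, φ 1-Lipschitz and t
of range r: δ = |t|(e^{μ′r} − 1), K = (e^{μ′r} − 1)·Schur norm of t = O(μ′)), then `ConjugationDefect (kernelForm t)
(mulOp ω) ‖·‖ K`. [folklore] [cite: Balaban1985Variational, (80) p. 290 (context)] -/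
theorem kernelForm_conjugationDefect (t : G → G → ℝ) (ω : G → ℝ) (δ : G → G → ℝ) {K : ℝ}
    (hδ : ∀ x y, 0 ≤ δ x y) (hrow : ∀ x, ∑ y, δ x y ≤ K) (hcol : ∀ y, ∑ x, δ x y ≤ K)
    (ht : ∀ x y, |t x y * ((ω x - ω y) * ω y)| ≤ δ x y * (|ω x| * |ω y|)) :
    ConjugationDefect (kernelForm t) (mulOp ω) (fun v => ‖v‖) K := by
  intro u
  rw [kernelForm_apply, kernelForm_apply]
  have hn : ‖mulOp ω u‖ ^ 2 = ∑ x, (ω x * u x) ^ 2 := by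
    rw [PiLp.norm_sq_eq_of_L2]
    exact Finset.sum_congr rfl fun x _ => by rw [mulOp_apply, Real.norm_eq_abs, sq_abs]
  simp only [mulOp_apply]
  -- defect = Σ t (ωx − ωy) ωy ux uy
  have hdef : ∑ x, ∑ y, t x y * (ω x * u x) * (ω y * u y) - ∑ x, ∑ y, t x y * u x * (ω y * (ω y * u y)) =
      ∑ x, ∑ y, t x y * ((ω x - ω y) * ω y) * (u x * u y) := by
    rw [← Finset.sum_sub_distrib]
    refine Finset.sum_congr rfl fun x _ => ?_
    rw [← Finset.sum_sub_distrib]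
    exact Finset.sum_congr rfl fun y _ => by ring
  have hbound : |∑ x, ∑ y, t x y * ((ω x - ω y) * ω y) * (u x * u y)| ≤ K * ∑ x, (ω x * u x) ^ 2 := by
    refine (Finset.abs_sum_le_sum_abs _ _).trans ?_
    refine (Finset.sum_le_sum fun x _ => Finset.abs_sum_le_sum_abs _ _).trans ?_
    have h := schur_amgm δ hδ hrow hcol (fun x => ω x * u x) (fun x => ω x * u x)
    calc ∑ x, ∑ y, |t x y * ((ω x - ω y) * ω y) * (u x * u y)|
        ≤ ∑ x, ∑ y, δ x y * (|ω x * u x| * |ω y * u y|) := by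
          refine Finset.sum_le_sum fun x _ => Finset.sum_le_sum fun y _ => ?_
          rw [abs_mul, abs_mul (u x), abs_mul (ω x), abs_mul (ω y)]
          have := mul_le_mul_of_nonneg_right (ht x y) (by positivity : 0 ≤ |u x| * |u y|)
          calc |t x y * ((ω x - ω y) * ω y)| * (|u x| * |u y|) ≤ δ x y * (|ω x| * |ω y|) * (|u x| * |u y|) := this
            _ = δ x y * (|ω x| * |u x| * (|ω y| * |u y|)) := by ring
      _ ≤ (K / 2) * (∑ x, (ω x * u x) ^ 2 + ∑ y, (ω y * u y) ^ 2) := h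
      _ = K * ∑ x, (ω x * u x) ^ 2 := by ring
  have hup := (abs_le.mp hbound).2
  rw [hn]
  linarith [hdef]

variable {ι : Type*} [Fintype ι]

/-- THE MODEL WITH FINITE-RANGE BLOCK TERMS: B = latticeForm c e s + kernelForm t is (s − T)-coercive and has conjugation
defect ≤ #ι·μ² + K, hence the Agmon bound ‖ωu‖ ≤ ρ/((s − T) − (#ι·μ² + K)) for its weak solutions — the kernel
skeleton of item (δ3) for «difference form + finite-range block operators». [folklore]
[cite: Balaban1985Variational, (79)–(80) p. 290 (context)] -/
theorem lattice_agmon_perturbed (c : ℝ) (e : ι → G) {s T μ K ρ : ℝ} (t : G → G → ℝ) (ω : G → ℝ)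
    (δ : G → G → ℝ) (hrowt : ∀ x, ∑ y, |t x y| ≤ T) (hcolt : ∀ y, ∑ x, |t x y| ≤ T)
    (hω : ∀ i x, c ^ 2 * (ω (x + e i) - ω x) ^ 2 ≤ μ ^ 2 * ω x ^ 2 ∧
      c ^ 2 * (ω (x + e i) - ω x) ^ 2 ≤ μ ^ 2 * ω (x + e i) ^ 2)
    (hδ : ∀ x y, 0 ≤ δ x y) (hrow : ∀ x, ∑ y, δ x y ≤ K) (hcol : ∀ y, ∑ x, δ x y ≤ K)
    (ht : ∀ x y, |t x y * ((ω x - ω y) * ω y)| ≤ δ x y * (|ω x| * |ω y|))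
    (hgap : Fintype.card ι * μ ^ 2 + K < s - T) (hρ : 0 ≤ ρ) {u : EuclideanSpace ℝ G}
    (J : EuclideanSpace ℝ G →ₗ[ℝ] ℝ) (hweak : ∀ v, (latticeForm c e s + kernelForm t) u v = J v)
    (hJ : ∀ v, |J (mulOp ω v)| ≤ ρ * ‖v‖) :
    ‖mulOp ω u‖ ≤ ρ / ((s - T) - (Fintype.card ι * μ ^ 2 + K)) := by
  have hcoer : ∀ v, (s - T) * ‖v‖ ^ 2 ≤ (latticeForm c e s + kernelForm t) v v := by
    intro v
    have h1 := latticeForm_coercive c e s v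
    have h2 := (abs_le.mp (kernelForm_self_le t hrowt hcolt v)).1
    simp only [LinearMap.add_apply]
    linarith
  exact agmon_weighted_response (latticeForm c e s + kernelForm t) (mulOp ω) (fun v => ‖v‖) J hgap hρ hcoer
    (conjugationDefect_add _ _ _ _ (latticeForm_conjugationDefect c e s ω hω)
      (kernelForm_conjugationDefect t ω δ hδ hrow hcol ht)) hweak hJ (norm_nonneg _)

end LatticeWitness

end

end Literature.MathematicalPhysics.QuantumFieldTheory.Balaban1983to89.T4ConvexResponse
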